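import Literature.NumberTheory.Sieve.KloostermanQuintilinearCongruencesWeights
import Literature.NumberTheory.Sieve.KloostermanQuintilinearCongruencesPoisson
import Literature.NumberTheory.Sieve.KloostermanQuintilinearCongruencesTools
import Literature.NumberTheory.Sieve.BombieriFriedlanderIwaniecLemma1OffdiagFromDI11
import Mathlib.NumberTheory.DirichletCharacter.Orthogonality
import Mathlib.NumberTheory.DirichletCharacter.Bounds
import HarnessLib

/-!
# Kloosterman quintilinear sums with congruences — the decomposition `𝒜₀ + 𝒜_∞ + ℬ`

Topic `Literature/NumberTheory/Sieve`.  Fourth glue file of the reduction of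
`Literature.NumberTheory.Sieve.AssingBlomerLi2020_theorem23` (Assing–Blomer–Li, Thm 2.3 at `a = 1` =
Drappeau 2017, Thm 2.1 corrected) to Drappeau's Proposition 4.13 (the spectral
Deshouillers–Iwaniec bound with nebentypus), following [Dr, §4.3.3] with the `𝒜₀` correction of
[BFI3]/[ABL, §3.3].  Everything here is PROVED; no named facts are introduced.

Contents.
* `drappeauTwistedKlSum`, `drappeauKregSq`, `drappeauKexcSq`: the objects of [Dr, Prop. 4.13]
  in the tree's vocabulary (`BFI.L1.kl k r n h = S(h, n r̄; k)`), so that Prop. 4.13 can be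
  quoted verbatim as a hypothesis of the final theorem
  (`KloostermanQuintilinearCongruencesReduction.lean`).
* `tsum_partition`: `Σ_{h ∈ ℤ} Ψ(h) = Ψ(0) + Σ_h θ_{J+1}(|h|)Ψ(h) + Σ_{j=-1}^{J} Σ_{h ≥ 1} φ_j(h)(Ψ(h)+Ψ(-h))`
  for the smooth `√2`-adic partition of `KloostermanQuintilinearSqrtTwoPartition.lean`.
* `lhsT`, `coefT`, `psiT`, `termA0`, `termAinf`, `termB` and **`lhsT_decomposition`**: after
  Poisson summation in `d` (`poisson_completion`, [Dr, (4.33)–(4.35)]) the left-hand side of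
  Theorem 2.3 (for one block of coefficients) splits as `𝒜₀ + 𝒜_∞ + Σ_j Σ_± ℬ_j^±`.
* **`termB_eq`** ([Dr, §4.3.3, treatment of `ℬ`], with the substitution `x = (D/SC)·s·c·v`
  instead of Drappeau's `ξ ↦ ξscq/m`): `ℬ_j^± = (D/(SCq)) φ(q)⁻¹ Σ_χ χ̄(c₀) ∫ 𝒮_χ(v) dv`, where
  `𝒮_χ(v)` is exactly the sum bounded by Prop. 4.13 with `M = a_j`, `t = ±(d₀ w₀ − (D/SC)v)/q`
  and the weight `W_{v,j}` of `KloostermanQuintilinearCongruencesWeights.lean`;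
  **`norm_termB_le`**: `|ℬ_j^±| ≤ 2 (D/(SCq)) · Z` whenever `|𝒮_χ(v)| ≤ Z` for `v ∈ [1/4, 2]`.
* **`norm_termA0_le`** (`𝒜₀`, Ramanujan sums, [ABL, §3.3]) and **`norm_termAinf_le`** (`𝒜_∞`,
  Fourier decay, [Dr, §4.3.3]).

## References
* [Drappeau2017] S. Drappeau, Proc. LMS 114 (2017), arXiv:1504.05549, Prop. 4.13 and §4.3.3.
* [AssingBlomerLi2020] E. Assing, V. Blomer, J. Li, arXiv:2005.13915, Thm 2.3, §3.3.
* [BFI3] E. Bombieri, J. Friedlander, H. Iwaniec, J. AMS 2 (1989), §8 (the `𝒜₀` correction).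
-/

noncomputable section

open Real MeasureTheory Filter Complex Finset
open scoped FourierTransform Topology ContDiff

namespace Literature.NumberTheory.Sieve

namespace KloostermanQuintilinear

open Literature.NumberTheory.LFunctions (kloostermanSum)
open Literature.NumberTheory.Sieve.FriedlanderIwaniecPrimes (summable_fourier_div)
open BFI.L1 (kl kl_eq_kloostermanSum norm_kl_le)

/-! ### Drappeau's Proposition 4.13: the objects -/

/-- Drappeau's twisted quintilinear sum of complete Kloosterman sums (the left-hand side of
[Dr, Prop. 4.13], with `χ(c)` for `χ̄(c)` — `χ` ranges over all characters):
`∑_{c,m,n,r,s ≥ 1, (sc, rq) = 1} b_{n,r,s} χ(c) g(c,m,n,r,s) e(mt) S(sgn·m q̄, n r̄; sc)`,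
the sums cut at `2C, 2M, 2N, 2R, 2S`, `S(h, n r̄; sc) = BFI.L1.kl (sc) r n h`.
[cite: Drappeau2017, Proposition 4.13] -/
def drappeauTwistedKlSum (q : ℕ) (χ : DirichletCharacter ℂ q) (t : ℝ) (sgn : ℤ)
    (C M N R S : ℝ) (b : ℕ → ℕ → ℕ → ℂ) (g : ℝ → ℝ → ℝ → ℝ → ℝ → ℂ) : ℂ :=
  ∑ c ∈ Icc 1 ⌊2 * C⌋₊, ∑ m ∈ Icc 1 ⌊2 * M⌋₊, ∑ n ∈ Icc 1 ⌊2 * N⌋₊, ∑ r ∈ Icc 1 ⌊2 * R⌋₊,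
    ∑ s ∈ Icc 1 ⌊2 * S⌋₊,
      if Nat.Coprime (s * c) (r * q) then
        b n r s * χ (c : ZMod q) * g c m n r s * (𝐞 ((m : ℝ) * t) : ℂ) *
          kl (s * c) r n (sgn * m * ((((q : ZMod (s * c)))⁻¹).val : ℤ))
      else 0

/-- `K_reg² = RS (C²S²R + MN + C²SN)(C²S²R + MN + C²SM)/(C²S²R + MN)`.
[cite: Drappeau2017, Proposition 4.13] -/
def drappeauKregSq (C M N R S : ℝ) : ℝ :=
  R * S * ((C ^ 2 * S ^ 2 * R + M * N + C ^ 2 * S * N) * (C ^ 2 * S ^ 2 * R + M * N + C ^ 2 * S * M) /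
    (C ^ 2 * S ^ 2 * R + M * N))

/-- `K_exc² = C³S²√(R(N + RS))` (Selberg's `θ ≤ 1/4`). [cite: Drappeau2017, Proposition 4.13] -/
def drappeauKexcSq (C N R S : ℝ) : ℝ :=
  C ^ 3 * S ^ 2 * Real.sqrt (R * (N + R * S))

/-! ### The `√2`-adic smooth partition of a sum over `ℤ` -/

/-- Pointwise: for an integer `h ≠ 0`, `1 = θ_{J+1}(|h|) + Σ_{j=-1}^{J} φ_j(|h|)`; for `h = 0`
every weight vanishes. [folklore] -/
theorem partition_weights_apply {J : ℤ} (hJ : -1 ≤ J) (h : ℤ) (x : ℂ) :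
    x = (if h = 0 then x else 0) + ((sqrtTwoStep (J + 1) |(h : ℝ)| : ℝ) : ℂ) * x +
      ∑ j ∈ Icc (-1 : ℤ) J, ((sqrtTwoBump j |(h : ℝ)| : ℝ) : ℂ) * x := by
  by_cases h0 : h = 0
  · subst h0
    have ha : |((0 : ℤ) : ℝ)| = 0 := by simp
    rw [if_pos rfl, ha, sqrtTwoStep_of_le (sqrtTwoScale_pos _).le,
      Finset.sum_eq_zero (fun j _ => by rw [sqrtTwoBump_of_le (sqrtTwoScale_pos _).le]; simp)]
    simp
  · have h1 : (1 : ℝ) ≤ |(h : ℝ)| := by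
      rw [← Int.cast_abs]; exact_mod_cast Int.one_le_abs h0
    rw [if_neg h0, zero_add, ← Finset.sum_mul, ← Complex.ofReal_sum,
      sum_Icc_sqrtTwoBump_eq_one_sub hJ h1]
    push_cast
    ring

/-- Integers `h` with `φ_j(|h|) ≠ 0` satisfy `1 ≤ |h| ≤ ⌊2a_j⌋₊`. [folklore] -/
theorem natAbs_bounds_of_sqrtTwoBump_ne_zero {j h : ℤ} (hh : sqrtTwoBump j |(h : ℝ)| ≠ 0) :
    1 ≤ h.natAbs ∧ h.natAbs ≤ ⌊2 * sqrtTwoScale j⌋₊ := by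
  obtain ⟨h1, h2⟩ := sqrtTwoBump_ne_zero hh
  have hpos : 0 < |(h : ℝ)| := (sqrtTwoScale_pos j).trans h1
  have h0 : h ≠ 0 := by
    rintro rfl
    simp at hpos
  have habs : ((h.natAbs : ℕ) : ℝ) = |(h : ℝ)| := by
    rw [Nat.cast_natAbs, Int.cast_abs]
  refine ⟨Int.natAbs_pos.mpr h0, Nat.le_floor ?_⟩
  rw [habs]
  exact h2.le

/-- `Σ'_{h ∈ ℤ} φ_j(|h|) Ψ(h) = Σ_{h=1}^{⌊2a_j⌋₊} φ_j(h) (Ψ(h) + Ψ(-h))` (a finite sum). [folklore] -/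
theorem tsum_sqrtTwoBump_mul (j : ℤ) (Ψ : ℤ → ℂ) :
    ∑' h : ℤ, ((sqrtTwoBump j |(h : ℝ)| : ℝ) : ℂ) * Ψ h =
      ∑ h ∈ Icc 1 ⌊2 * sqrtTwoScale j⌋₊,
        ((sqrtTwoBump j h : ℝ) : ℂ) * (Ψ h + Ψ (-(h : ℤ))) := by
  classical
  set H := ⌊2 * sqrtTwoScale j⌋₊ with hH
  set f : ℤ → ℂ := fun h => ((sqrtTwoBump j |(h : ℝ)| : ℝ) : ℂ) * Ψ h with hf
  set pos : Finset ℤ := (Icc 1 H).image (fun n : ℕ => (n : ℤ)) with hposdef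
  set neg : Finset ℤ := (Icc 1 H).image (fun n : ℕ => -(n : ℤ)) with hnegdef
  have hdisj : Disjoint pos neg := by
    rw [Finset.disjoint_left]
    intro x hx hx'
    rw [hposdef, Finset.mem_image] at hx
    rw [hnegdef, Finset.mem_image] at hx'
    obtain ⟨a, ha, rfl⟩ := hx
    obtain ⟨b, hb, hb'⟩ := hx'
    rw [Finset.mem_Icc] at ha hb
    omega
  have hzero : ∀ h ∉ pos ∪ neg, f h = 0 := by
    intro h hh
    by_contra hne
    have hb : sqrtTwoBump j |(h : ℝ)| ≠ 0 := by
      intro h0; apply hne; simp [hf, h0]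
    obtain ⟨h1, h2⟩ := natAbs_bounds_of_sqrtTwoBump_ne_zero hb
    apply hh
    rw [Finset.mem_union]
    rcases Int.natAbs_eq h with he | he
    · left
      exact Finset.mem_image.mpr ⟨h.natAbs, Finset.mem_Icc.mpr ⟨h1, h2⟩, he.symm⟩
    · right
      exact Finset.mem_image.mpr ⟨h.natAbs, Finset.mem_Icc.mpr ⟨h1, h2⟩, he.symm⟩
  rw [tsum_eq_sum hzero, Finset.sum_union hdisj]
  have hinj1 : Set.InjOn (fun n : ℕ => (n : ℤ)) (Icc 1 H : Finset ℕ) := by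
    intro a _ b _ h
    have h' : (a : ℤ) = b := h
    exact_mod_cast h'
  have hinj2 : Set.InjOn (fun n : ℕ => -(n : ℤ)) (Icc 1 H : Finset ℕ) := by
    intro a _ b _ h
    have h' : -(a : ℤ) = -b := h
    have h'' := neg_injective h'
    exact_mod_cast h''
  rw [hposdef, hnegdef, Finset.sum_image hinj1, Finset.sum_image hinj2, ← Finset.sum_add_distrib]
  refine Finset.sum_congr rfl fun n _ => ?_
  simp only [hf, Int.cast_neg, Int.cast_natCast, abs_neg, Nat.abs_cast]
  ring

/-- **Smooth `√2`-adic partition of a sum over `ℤ`**: for summable `Ψ` and `J ≥ -1`,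
`Σ'_h Ψ(h) = Ψ(0) + Σ'_h θ_{J+1}(|h|)Ψ(h) + Σ_{j=-1}^{J} Σ_{h=1}^{⌊2a_j⌋₊} φ_j(h)(Ψ(h) + Ψ(-h))`.
[folklore] -/
theorem tsum_partition {Ψ : ℤ → ℂ} (hΨ : Summable Ψ) {J : ℤ} (hJ : -1 ≤ J) :
    ∑' h, Ψ h = Ψ 0 + ∑' h : ℤ, ((sqrtTwoStep (J + 1) |(h : ℝ)| : ℝ) : ℂ) * Ψ h +
      ∑ j ∈ Icc (-1 : ℤ) J, ∑ h ∈ Icc 1 ⌊2 * sqrtTwoScale j⌋₊,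
        ((sqrtTwoBump j h : ℝ) : ℂ) * (Ψ h + Ψ (-(h : ℤ))) := by
  classical
  have hbd : ∀ w : ℤ → ℝ, (∀ h, |w h| ≤ 1) → Summable fun h => ((w h : ℝ) : ℂ) * Ψ h := by
    intro w hw
    refine Summable.of_norm_bounded hΨ.norm fun h => ?_
    rw [norm_mul, Complex.norm_real, Real.norm_eq_abs]
    exact mul_le_of_le_one_left (norm_nonneg _) (hw h)
  have s0 : Summable fun h : ℤ => if h = 0 then Ψ h else 0 := by
    apply summable_of_ne_finset_zero (s := {0})
    intro h hh
    rw [Finset.mem_singleton] at hh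
    rw [if_neg hh]
  have s1 : Summable fun h : ℤ => ((sqrtTwoStep (J + 1) |(h : ℝ)| : ℝ) : ℂ) * Ψ h :=
    hbd _ fun h => by
      rw [abs_of_nonneg (sqrtTwoStep_mem_Icc _ _).1]
      exact (sqrtTwoStep_mem_Icc _ _).2
  have s2 : ∀ j ∈ Icc (-1 : ℤ) J,
      Summable fun h : ℤ => ((sqrtTwoBump j |(h : ℝ)| : ℝ) : ℂ) * Ψ h :=
    fun j _ => hbd _ fun h => abs_sqrtTwoBump_le_one j _
  have s3 : Summable fun h : ℤ =>
      ∑ j ∈ Icc (-1 : ℤ) J, ((sqrtTwoBump j |(h : ℝ)| : ℝ) : ℂ) * Ψ h :=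
    summable_sum s2
  calc ∑' h, Ψ h
      = ∑' h : ℤ, ((if h = 0 then Ψ h else 0) +
          ((sqrtTwoStep (J + 1) |(h : ℝ)| : ℝ) : ℂ) * Ψ h +
          ∑ j ∈ Icc (-1 : ℤ) J, ((sqrtTwoBump j |(h : ℝ)| : ℝ) : ℂ) * Ψ h) :=
        tsum_congr fun h => partition_weights_apply hJ h (Ψ h)
    _ = ∑' h : ℤ, (if h = 0 then Ψ h else 0) +
          ∑' h : ℤ, ((sqrtTwoStep (J + 1) |(h : ℝ)| : ℝ) : ℂ) * Ψ h +
          ∑' h : ℤ, ∑ j ∈ Icc (-1 : ℤ) J, ((sqrtTwoBump j |(h : ℝ)| : ℝ) : ℂ) * Ψ h := by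
        rw [(s0.add s1).tsum_add s3, s0.tsum_add s1]
    _ = _ := by
        rw [tsum_eq_single 0 (fun h hh => if_neg hh), if_pos rfl, Summable.tsum_finsetSum s2]
        congr 1
        exact Finset.sum_congr rfl fun j _ => tsum_sqrtTwoBump_mul j Ψ

/-! ### The objects of [Dr, §4.3.3] -/

/-- `w = \overline{sc} (mod q)` as a natural number. [folklore] -/
def wInv (q s c : ℕ) : ℕ := ((((s * c : ℕ) : ZMod q))⁻¹).val

/-- `w` only depends on `s, c` modulo `q`. [folklore] -/
theorem wInv_congr {q s c s₀ c₀ : ℕ} (hs : s ≡ s₀ [MOD q]) (hc : c ≡ c₀ [MOD q]) :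
    wInv q s c = wInv q s₀ c₀ := by
  unfold wInv
  rw [(ZMod.natCast_eq_natCast_iff _ _ _).mpr (Nat.ModEq.mul hs hc)]

/-- The dual term `Ψ_{c,n,r,s}(h) = 𝓕[g(c,·,n,r,s)](h/(qsc)) · e(h d₀ \overline{sc}/q) · S(h q̄, n r̄; sc)`
of the Poisson formula [Dr, (4.33)–(4.35)], the Kloosterman sum written as
`BFI.L1.kl (sc) r n (h q̄)`. [cite: Drappeau2017, §4.3.3] -/
def psiT (g : ℝ → ℝ → ℝ → ℝ → ℝ → ℂ) (q d₀ c n r s : ℕ) (h : ℤ) : ℂ :=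
  𝓕 (fun x : ℝ => g c x n r s) ((h : ℝ) / ((q * (s * c) : ℕ) : ℝ)) *
    ((𝐞 ((h : ℝ) * d₀ * ((wInv q s c : ℕ) : ℝ) / q) : ℂ) *
      kl (s * c) r n (h * ((((q : ZMod (s * c)))⁻¹).val : ℤ)))

/-- The coefficient `b_{n,r,s} 1_{c ≡ c₀ (q)} 1_{(qr, sc) = 1} / (q s c)`. [folklore] -/
def coefT (b : ℕ → ℕ → ℕ → ℂ) (q c₀ c n r s : ℕ) : ℂ :=
  if c ≡ c₀ [MOD q] ∧ Nat.Coprime (q * r) (s * c) then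
    b n r s * (((q * (s * c) : ℕ) : ℂ))⁻¹ else 0

/-- The left-hand side of [ABL, Thm 2.3] (without the norm) for coefficients `b`, the `n`-sum cut
at `Nn`. [cite: AssingBlomerLi2020, Theorem 2.3] -/
def lhsT (b : ℕ → ℕ → ℕ → ℂ) (g : ℝ → ℝ → ℝ → ℝ → ℝ → ℂ) (q c₀ d₀ : ℕ) (C D R S : ℝ)
    (Nn : ℕ) : ℂ :=
  ∑ c ∈ Icc 1 ⌊2 * C⌋₊, ∑ d ∈ Icc 1 ⌊2 * D⌋₊, ∑ n ∈ Icc 1 Nn, ∑ r ∈ Icc 1 ⌊2 * R⌋₊,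
    ∑ s ∈ Icc 1 ⌊2 * S⌋₊,
      (if (c ≡ c₀ [MOD q] ∧ d ≡ d₀ [MOD q] ∧ Nat.Coprime (q * r * d) (s * c)) then
        b n r s * g c d n r s *
          (𝐞 ((n : ℝ) * ((((r * d : ℕ) : ZMod (s * c))⁻¹).val : ℝ) / ((s : ℝ) * c)) : ℂ)
      else 0)

/-- `𝒜₀`: the zero frequency. [cite: Drappeau2017, §4.3.3] -/
def termA0 (b : ℕ → ℕ → ℕ → ℂ) (g : ℝ → ℝ → ℝ → ℝ → ℝ → ℂ) (q c₀ d₀ : ℕ) (C R S : ℝ)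
    (Nn : ℕ) : ℂ :=
  ∑ c ∈ Icc 1 ⌊2 * C⌋₊, ∑ n ∈ Icc 1 Nn, ∑ r ∈ Icc 1 ⌊2 * R⌋₊, ∑ s ∈ Icc 1 ⌊2 * S⌋₊,
    coefT b q c₀ c n r s * psiT g q d₀ c n r s 0

/-- `𝒜_∞`: the frequencies beyond the smooth cut `θ_{J+1}`. [cite: Drappeau2017, §4.3.3] -/
def termAinf (b : ℕ → ℕ → ℕ → ℂ) (g : ℝ → ℝ → ℝ → ℝ → ℝ → ℂ) (q c₀ d₀ : ℕ) (C R S : ℝ)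
    (Nn : ℕ) (J : ℤ) : ℂ :=
  ∑ c ∈ Icc 1 ⌊2 * C⌋₊, ∑ n ∈ Icc 1 Nn, ∑ r ∈ Icc 1 ⌊2 * R⌋₊, ∑ s ∈ Icc 1 ⌊2 * S⌋₊,
    coefT b q c₀ c n r s *
      ∑' h : ℤ, ((sqrtTwoStep (J + 1) |(h : ℝ)| : ℝ) : ℂ) * psiT g q d₀ c n r s h

/-- `ℬ_j^σ`: the piece of the middle frequencies carried by `φ_j`, sign `σ = ±1`.
[cite: Drappeau2017, §4.3.3] -/
def termB (b : ℕ → ℕ → ℕ → ℂ) (g : ℝ → ℝ → ℝ → ℝ → ℝ → ℂ) (q c₀ d₀ : ℕ) (C R S : ℝ)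
    (Nn : ℕ) (j σ : ℤ) : ℂ :=
  ∑ c ∈ Icc 1 ⌊2 * C⌋₊, ∑ n ∈ Icc 1 Nn, ∑ r ∈ Icc 1 ⌊2 * R⌋₊, ∑ s ∈ Icc 1 ⌊2 * S⌋₊,
    coefT b q c₀ c n r s *
      ∑ h ∈ Icc 1 ⌊2 * sqrtTwoScale j⌋₊,
        ((sqrtTwoBump j h : ℝ) : ℂ) * psiT g q d₀ c n r s (σ * h)

/-! ### Slices of `g` in the `d`-variable -/

/-- The `d`-slice `x ↦ g(c,x,n,r,s)` has compact support in `[D, 2D]`. [folklore] -/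
theorem hasCompactSupport_slice {g : ℝ → ℝ → ℝ → ℝ → ℝ → ℂ} {C D : ℝ}
    (hsupp : ∀ c d n r s, g c d n r s ≠ 0 → C < c ∧ c ≤ 2 * C ∧ D < d ∧ d ≤ 2 * D)
    (c n r s : ℝ) : HasCompactSupport (fun x : ℝ => g c x n r s) := by
  refine HasCompactSupport.of_support_subset_isCompact (isCompact_Icc (a := D) (b := 2 * D)) ?_
  intro x hx
  have h := hsupp _ _ _ _ _ (Function.mem_support.mp hx)
  exact ⟨h.2.2.1.le, h.2.2.2⟩

/-- Integer points of the support of the `d`-slice lie in `[1, ⌊2D⌋₊]` (for `D ≥ 1`). [folklore] -/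
theorem slice_int_support {g : ℝ → ℝ → ℝ → ℝ → ℝ → ℂ} {C D : ℝ} (hD : 1 ≤ D)
    (hsupp : ∀ c d n r s, g c d n r s ≠ 0 → C < c ∧ c ≤ 2 * C ∧ D < d ∧ d ≤ 2 * D)
    (c n r s : ℝ) : ∀ m : ℤ, (fun x : ℝ => g c x n r s) m ≠ 0 → 1 ≤ m ∧ m ≤ (⌊2 * D⌋₊ : ℕ) := by
  intro m hm
  obtain ⟨-, -, h1, h2⟩ := hsupp _ _ _ _ _ hm
  have hm1 : (1 : ℝ) < m := by linarith
  have hm0 : (0 : ℤ) ≤ m := by exact_mod_cast (zero_le_one.trans hm1.le)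
  refine ⟨by exact_mod_cast hm1.le, ?_⟩
  have hnat : m.toNat ≤ ⌊2 * D⌋₊ := by
    refine Nat.le_floor ?_
    have : ((m.toNat : ℕ) : ℝ) = (m : ℝ) := by exact_mod_cast Int.toNat_of_nonneg hm0
    rw [this]
    exact h2
  calc m = (m.toNat : ℤ) := (Int.toNat_of_nonneg hm0).symm
    _ ≤ _ := by exact_mod_cast hnat

/-- **Summability of `Ψ_{c,n,r,s}`** (Fourier decay of a smooth compactly supported slice).
[folklore] -/
theorem summable_psiT {g : ℝ → ℝ → ℝ → ℝ → ℝ → ℂ} (hg : ContDiff ℝ ∞ (U5 g)) {C D : ℝ}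
    (hsupp : ∀ c d n r s, g c d n r s ≠ 0 → C < c ∧ c ≤ 2 * C ∧ D < d ∧ d ≤ 2 * D)
    {q : ℕ} (hq : 0 < q) (d₀ : ℕ) {c : ℕ} (n r : ℕ) {s : ℕ} (hc : 0 < c) (hs : 0 < s) :
    Summable (psiT g q d₀ c n r s) := by
  have hFcd : ContDiff ℝ ∞ (fun x : ℝ => g c x n r s) := contDiff_slice_d hg _ _ _ _
  have hFc := hasCompactSupport_slice hsupp (c : ℝ) n r s
  have hd : (0 : ℝ) < ((q * (s * c) : ℕ) : ℝ) := by positivity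
  have h1 := summable_fourier_div hFcd hFc hd
  refine Summable.of_norm_bounded (h1.norm.mul_right ((s * c : ℕ) : ℝ)) fun h => ?_
  unfold psiT
  rw [norm_mul, norm_mul, Circle.norm_coe, one_mul]
  exact mul_le_mul_of_nonneg_left (norm_kl_le _ _ _ _) (norm_nonneg _)

/-! ### Poisson summation in `d`, term by term -/

/-- **The inner `d`-sum** of Theorem 2.3 for fixed `(c, n, r, s)` equals
`coefT · Σ'_h Ψ_{c,n,r,s}(h)` ([Dr, (4.33)–(4.35)] = `poisson_completion`). [cite: Drappeau2017, §4.3.3] -/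
theorem inner_d_sum_eq {g : ℝ → ℝ → ℝ → ℝ → ℝ → ℂ} (hg : ContDiff ℝ ∞ (U5 g)) {C D : ℝ}
    (hD : 1 ≤ D)
    (hsupp : ∀ c d n r s, g c d n r s ≠ 0 → C < c ∧ c ≤ 2 * C ∧ D < d ∧ d ≤ 2 * D)
    {q : ℕ} (hq : 0 < q) (c₀ d₀ : ℕ) (b : ℕ → ℕ → ℕ → ℂ) {c : ℕ} (n r : ℕ) {s : ℕ}
    (hc : 0 < c) (hs : 0 < s) :
    ∑ d ∈ Icc 1 ⌊2 * D⌋₊,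
        (if (c ≡ c₀ [MOD q] ∧ d ≡ d₀ [MOD q] ∧ Nat.Coprime (q * r * d) (s * c)) then
          b n r s * g c d n r s *
            (𝐞 ((n : ℝ) * ((((r * d : ℕ) : ZMod (s * c))⁻¹).val : ℝ) / ((s : ℝ) * c)) : ℂ)
        else 0) =
      coefT b q c₀ c n r s * ∑' h : ℤ, psiT g q d₀ c n r s h := by
  unfold coefT
  by_cases hcc : c ≡ c₀ [MOD q]
  swap
  · rw [if_neg (fun h => hcc h.1), zero_mul]
    exact Finset.sum_eq_zero fun d _ => if_neg fun h => hcc h.1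
  by_cases hcop : Nat.Coprime (q * r) (s * c)
  swap
  · rw [if_neg (fun h => hcop h.2), zero_mul]
    refine Finset.sum_eq_zero fun d _ => if_neg fun h => hcop ?_
    exact Nat.Coprime.coprime_mul_right h.2.2
  rw [if_pos ⟨hcc, hcop⟩]
  haveI : NeZero (s * c) := ⟨(Nat.mul_pos hs hc).ne'⟩
  have hFcd : ContDiff ℝ ∞ (fun x : ℝ => g c x n r s) := contDiff_slice_d hg _ _ _ _
  have hFc := hasCompactSupport_slice hsupp (c : ℝ) n r s
  have hFL := slice_int_support hD hsupp (c : ℝ) n r s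
  have hP := poisson_completion hFcd hFc hFL hq hcop d₀ n
  have hL : ∀ d : ℕ, (if (c ≡ c₀ [MOD q] ∧ d ≡ d₀ [MOD q] ∧ Nat.Coprime (q * r * d) (s * c)) then
        b n r s * g c d n r s *
          (𝐞 ((n : ℝ) * ((((r * d : ℕ) : ZMod (s * c))⁻¹).val : ℝ) / ((s : ℝ) * c)) : ℂ)
        else 0) =
      b n r s * (if (d ≡ d₀ [MOD q] ∧ Nat.Coprime (q * r * d) (s * c)) then
        (fun x : ℝ => g c x n r s) d *
          (𝐞 ((n : ℝ) * ((((r * d : ℕ) : ZMod (s * c))⁻¹).val : ℝ) / ((s : ℝ) * c)) : ℂ)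
        else 0) := by
    intro d
    by_cases hd : d ≡ d₀ [MOD q] ∧ Nat.Coprime (q * r * d) (s * c)
    · rw [if_pos ⟨hcc, hd⟩, if_pos hd]; ring
    · rw [if_neg (fun h => hd h.2), if_neg hd, mul_zero]
  rw [Finset.sum_congr rfl (fun d _ => hL d), ← Finset.mul_sum, hP, ← mul_assoc]
  congr 1
  refine tsum_congr fun h => ?_
  unfold psiT wInv
  rw [kl_eq_kloostermanSum (Nat.Coprime.coprime_mul_left hcop) n]
  congr 2
  push_cast
  rw [ZMod.natCast_zmod_val]

/-! ### The decomposition `𝒜₀ + 𝒜_∞ + ℬ` -/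

/-- Moving an innermost fifth sum to the front. [folklore] -/
theorem sum_comm_out4 {α β γ δ κ : Type*} (sa : Finset α) (sb : Finset β) (sc : Finset γ)
    (sd : Finset δ) (t : Finset κ) (F : α → β → γ → δ → κ → ℂ) :
    ∑ a ∈ sa, ∑ b ∈ sb, ∑ c ∈ sc, ∑ d ∈ sd, ∑ j ∈ t, F a b c d j =
      ∑ j ∈ t, ∑ a ∈ sa, ∑ b ∈ sb, ∑ c ∈ sc, ∑ d ∈ sd, F a b c d j := by
  have h3 : ∀ a b c, ∑ d ∈ sd, ∑ j ∈ t, F a b c d j = ∑ j ∈ t, ∑ d ∈ sd, F a b c d j :=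
    fun a b c => Finset.sum_comm
  have h2 : ∀ a b, ∑ c ∈ sc, ∑ d ∈ sd, ∑ j ∈ t, F a b c d j =
      ∑ j ∈ t, ∑ c ∈ sc, ∑ d ∈ sd, F a b c d j := by
    intro a b
    simp_rw [h3]
    exact Finset.sum_comm
  have h1 : ∀ a, ∑ b ∈ sb, ∑ c ∈ sc, ∑ d ∈ sd, ∑ j ∈ t, F a b c d j =
      ∑ j ∈ t, ∑ b ∈ sb, ∑ c ∈ sc, ∑ d ∈ sd, F a b c d j := by
    intro a
    simp_rw [h2]
    exact Finset.sum_comm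
  simp_rw [h1]
  exact Finset.sum_comm

/-- **`𝒜₀ + 𝒜_∞ + ℬ`** ([Dr, §4.3.3]): after Poisson summation in `d` and the smooth `√2`-adic
partition of the dual variable, the left-hand side of Theorem 2.3 (for one block of
coefficients, `n`-sum cut at `Nn`) splits as
`𝒜₀ + 𝒜_∞(J) + Σ_{j=-1}^{J} (ℬ_j^+ + ℬ_j^-)`. [cite: Drappeau2017, §4.3.3] -/
theorem lhsT_decomposition {g : ℝ → ℝ → ℝ → ℝ → ℝ → ℂ} (hg : ContDiff ℝ ∞ (U5 g)) {C D : ℝ}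
    (hD : 1 ≤ D)
    (hsupp : ∀ c d n r s, g c d n r s ≠ 0 → C < c ∧ c ≤ 2 * C ∧ D < d ∧ d ≤ 2 * D)
    {q : ℕ} (hq : 0 < q) (c₀ d₀ : ℕ) (b : ℕ → ℕ → ℕ → ℂ) (R S : ℝ) (Nn : ℕ) {J : ℤ}
    (hJ : -1 ≤ J) :
    lhsT b g q c₀ d₀ C D R S Nn =
      termA0 b g q c₀ d₀ C R S Nn + termAinf b g q c₀ d₀ C R S Nn J +
        ∑ j ∈ Icc (-1 : ℤ) J, (termB b g q c₀ d₀ C R S Nn j 1 + termB b g q c₀ d₀ C R S Nn j (-1)) := by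
  unfold lhsT termA0 termAinf termB
  -- pointwise identity for each `(c, n, r, s)`
  have key : ∀ c ∈ Icc 1 ⌊2 * C⌋₊, ∀ n ∈ Icc 1 Nn, ∀ r ∈ Icc 1 ⌊2 * R⌋₊, ∀ s ∈ Icc 1 ⌊2 * S⌋₊,
      ∑ d ∈ Icc 1 ⌊2 * D⌋₊,
        (if (c ≡ c₀ [MOD q] ∧ d ≡ d₀ [MOD q] ∧ Nat.Coprime (q * r * d) (s * c)) then
          b n r s * g c d n r s *
            (𝐞 ((n : ℝ) * ((((r * d : ℕ) : ZMod (s * c))⁻¹).val : ℝ) / ((s : ℝ) * c)) : ℂ)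
        else 0) =
      coefT b q c₀ c n r s * psiT g q d₀ c n r s 0 +
        coefT b q c₀ c n r s *
          ∑' h : ℤ, ((sqrtTwoStep (J + 1) |(h : ℝ)| : ℝ) : ℂ) * psiT g q d₀ c n r s h +
        ∑ j ∈ Icc (-1 : ℤ) J,
          (coefT b q c₀ c n r s * ∑ h ∈ Icc 1 ⌊2 * sqrtTwoScale j⌋₊,
              ((sqrtTwoBump j h : ℝ) : ℂ) * psiT g q d₀ c n r s (1 * h) +
            coefT b q c₀ c n r s * ∑ h ∈ Icc 1 ⌊2 * sqrtTwoScale j⌋₊,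
              ((sqrtTwoBump j h : ℝ) : ℂ) * psiT g q d₀ c n r s (-1 * h)) := by
    intro c hc n _ r _ s hs
    have hc0 : 0 < c := (Finset.mem_Icc.mp hc).1
    have hs0 : 0 < s := (Finset.mem_Icc.mp hs).1
    rw [inner_d_sum_eq hg hD hsupp hq c₀ d₀ b n r hc0 hs0,
      tsum_partition (summable_psiT hg hsupp hq d₀ n r hc0 hs0) hJ, mul_add, mul_add,
      Finset.mul_sum]
    congr 1
    refine Finset.sum_congr rfl fun j _ => ?_
    rw [← mul_add, ← Finset.sum_add_distrib]
    congr 1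
    refine Finset.sum_congr rfl fun h _ => ?_
    rw [one_mul, neg_one_mul, mul_add]
  -- move the `d`-sum inside (past `n`, `r`, `s`)
  have comm : ∀ c ∈ Icc 1 ⌊2 * C⌋₊,
      ∑ d ∈ Icc 1 ⌊2 * D⌋₊, ∑ n ∈ Icc 1 Nn, ∑ r ∈ Icc 1 ⌊2 * R⌋₊, ∑ s ∈ Icc 1 ⌊2 * S⌋₊,
        (if (c ≡ c₀ [MOD q] ∧ d ≡ d₀ [MOD q] ∧ Nat.Coprime (q * r * d) (s * c)) then
          b n r s * g c d n r s *
            (𝐞 ((n : ℝ) * ((((r * d : ℕ) : ZMod (s * c))⁻¹).val : ℝ) / ((s : ℝ) * c)) : ℂ)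
        else 0) =
      ∑ n ∈ Icc 1 Nn, ∑ r ∈ Icc 1 ⌊2 * R⌋₊, ∑ s ∈ Icc 1 ⌊2 * S⌋₊, ∑ d ∈ Icc 1 ⌊2 * D⌋₊,
        (if (c ≡ c₀ [MOD q] ∧ d ≡ d₀ [MOD q] ∧ Nat.Coprime (q * r * d) (s * c)) then
          b n r s * g c d n r s *
            (𝐞 ((n : ℝ) * ((((r * d : ℕ) : ZMod (s * c))⁻¹).val : ℝ) / ((s : ℝ) * c)) : ℂ)
        else 0) := by
    intro c _
    rw [Finset.sum_comm]
    refine Finset.sum_congr rfl fun n _ => ?_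
    rw [Finset.sum_comm]
    refine Finset.sum_congr rfl fun r _ => ?_
    rw [Finset.sum_comm]
  rw [Finset.sum_congr rfl comm]
  rw [Finset.sum_congr rfl fun c hc => Finset.sum_congr rfl fun n hn =>
        Finset.sum_congr rfl fun r hr => Finset.sum_congr rfl fun s hs => key c hc n hn r hr s hs]
  simp only [Finset.sum_add_distrib]
  congr 1
  congr 1
  · exact sum_comm_out4 _ _ _ _ _ _
  · exact sum_comm_out4 _ _ _ _ _ _


/-! ### Generic finite-sum / integral bookkeeping in five variables -/

/-- Moving an innermost fourth sum to the front. [folklore] -/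
theorem sum_comm_out3 {α β γ κ : Type*} (sa : Finset α) (sb : Finset β) (sc : Finset γ)
    (t : Finset κ) (F : α → β → γ → κ → ℂ) :
    ∑ a ∈ sa, ∑ b ∈ sb, ∑ c ∈ sc, ∑ j ∈ t, F a b c j =
      ∑ j ∈ t, ∑ a ∈ sa, ∑ b ∈ sb, ∑ c ∈ sc, F a b c j := by
  have h2 : ∀ a b, ∑ c ∈ sc, ∑ j ∈ t, F a b c j = ∑ j ∈ t, ∑ c ∈ sc, F a b c j :=
    fun a b => Finset.sum_comm
  have h1 : ∀ a, ∑ b ∈ sb, ∑ c ∈ sc, ∑ j ∈ t, F a b c j =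
      ∑ j ∈ t, ∑ b ∈ sb, ∑ c ∈ sc, F a b c j := by
    intro a
    simp_rw [h2]
    exact Finset.sum_comm
  simp_rw [h1]
  exact Finset.sum_comm

/-- Moving an outermost sum inside five others. [folklore] -/
theorem sum_comm_in5 {χT α β γ δ ε : Type*} (sx : Finset χT) (sa : Finset α) (sb : Finset β)
    (sc : Finset γ) (sd : Finset δ) (se : Finset ε) (F : χT → α → β → γ → δ → ε → ℂ) :
    ∑ x ∈ sx, ∑ a ∈ sa, ∑ b ∈ sb, ∑ c ∈ sc, ∑ d ∈ sd, ∑ e ∈ se, F x a b c d e =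
      ∑ a ∈ sa, ∑ b ∈ sb, ∑ c ∈ sc, ∑ d ∈ sd, ∑ e ∈ se, ∑ x ∈ sx, F x a b c d e := by
  rw [Finset.sum_comm]
  refine Finset.sum_congr rfl fun a _ => ?_
  rw [Finset.sum_comm]
  refine Finset.sum_congr rfl fun b _ => ?_
  rw [Finset.sum_comm]
  refine Finset.sum_congr rfl fun c _ => ?_
  rw [Finset.sum_comm]
  refine Finset.sum_congr rfl fun d _ => ?_
  rw [Finset.sum_comm]

/-- Interchanging an integral with a five-fold finite sum of integrable functions. [folklore] -/
theorem integral_finset_sum5 {α β γ δ ε : Type*} (sa : Finset α) (sb : Finset β) (sc : Finset γ)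
    (sd : Finset δ) (se : Finset ε) (f : α → β → γ → δ → ε → ℝ → ℂ)
    (hf : ∀ a ∈ sa, ∀ b ∈ sb, ∀ c ∈ sc, ∀ d ∈ sd, ∀ e ∈ se, Integrable (f a b c d e)) :
    ∫ v : ℝ, ∑ a ∈ sa, ∑ b ∈ sb, ∑ c ∈ sc, ∑ d ∈ sd, ∑ e ∈ se, f a b c d e v =
      ∑ a ∈ sa, ∑ b ∈ sb, ∑ c ∈ sc, ∑ d ∈ sd, ∑ e ∈ se, ∫ v : ℝ, f a b c d e v := by
  have i4 : ∀ a ∈ sa, ∀ b ∈ sb, ∀ c ∈ sc, ∀ d ∈ sd,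
      Integrable (fun v : ℝ => ∑ e ∈ se, f a b c d e v) := fun a ha b hb c hc d hd =>
    integrable_finsetSum _ fun e he => hf a ha b hb c hc d hd e he
  have i3 : ∀ a ∈ sa, ∀ b ∈ sb, ∀ c ∈ sc,
      Integrable (fun v : ℝ => ∑ d ∈ sd, ∑ e ∈ se, f a b c d e v) := fun a ha b hb c hc =>
    integrable_finsetSum _ fun d hd => i4 a ha b hb c hc d hd
  have i2 : ∀ a ∈ sa, ∀ b ∈ sb,
      Integrable (fun v : ℝ => ∑ c ∈ sc, ∑ d ∈ sd, ∑ e ∈ se, f a b c d e v) := fun a ha b hb =>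
    integrable_finsetSum _ fun c hc => i3 a ha b hb c hc
  have i1 : ∀ a ∈ sa,
      Integrable (fun v : ℝ => ∑ b ∈ sb, ∑ c ∈ sc, ∑ d ∈ sd, ∑ e ∈ se, f a b c d e v) :=
    fun a ha => integrable_finsetSum _ fun b hb => i2 a ha b hb
  rw [integral_finsetSum _ i1]
  refine Finset.sum_congr rfl fun a ha => ?_
  rw [integral_finsetSum _ (i2 a ha)]
  refine Finset.sum_congr rfl fun b hb => ?_
  rw [integral_finsetSum _ (i3 a ha b hb)]
  refine Finset.sum_congr rfl fun c hc => ?_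
  rw [integral_finsetSum _ (i4 a ha b hb c hc)]
  refine Finset.sum_congr rfl fun d hd => ?_
  rw [integral_finsetSum _ (hf a ha b hb c hc d hd)]

/-! ### The middle frequencies: `ℬ_j^σ` as an average of Proposition 4.13 sums -/

/-- The phase `t_v = σ (d₀ w₀ − θ v)/q` of [Dr, §4.3.3] after the substitution `x = θ s c v`.
[folklore] -/
def tPhase (q : ℕ) (σ : ℤ) (d₀ w₀ : ℕ) (θ v : ℝ) : ℝ := σ * (d₀ * w₀ - θ * v) / q

/-- The summand of `drappeauTwistedKlSum` without the character, for the weight `W_{v,j}` and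
the phase `t_v`. [folklore] -/
def ySummand (b : ℕ → ℕ → ℕ → ℂ) (g : ℝ → ℝ → ℝ → ℝ → ℝ → ℂ) (q : ℕ) (C D N' R S : ℝ)
    (j σ : ℤ) (d₀ w₀ : ℕ) (v : ℝ) (c m n r s : ℕ) : ℂ :=
  if Nat.Coprime (s * c) (r * q) then
    b n r s * weightW g C D N' R S v j c m n r s *
      (𝐞 ((m : ℝ) * tPhase q σ d₀ w₀ (D / (S * C)) v) : ℂ) *
        kl (s * c) r n (σ * m * ((((q : ZMod (s * c)))⁻¹).val : ℤ))
  else 0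

/-- The Prop-4.13 sum for `W_{v,j}` and `t_v`, summand by summand. [folklore] -/
theorem drappeauTwistedKlSum_weightW (q : ℕ) (χ : DirichletCharacter ℂ q) (σ : ℤ)
    (C D N' R S : ℝ) (b : ℕ → ℕ → ℕ → ℂ) (g : ℝ → ℝ → ℝ → ℝ → ℝ → ℂ) (j : ℤ) (d₀ w₀ : ℕ)
    (v : ℝ) :
    drappeauTwistedKlSum q χ (tPhase q σ d₀ w₀ (D / (S * C)) v) σ C (sqrtTwoScale j) N' R S b
        (weightW g C D N' R S v j) =
      ∑ c ∈ Icc 1 ⌊2 * C⌋₊, ∑ m ∈ Icc 1 ⌊2 * sqrtTwoScale j⌋₊, ∑ n ∈ Icc 1 ⌊2 * N'⌋₊,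
        ∑ r ∈ Icc 1 ⌊2 * R⌋₊, ∑ s ∈ Icc 1 ⌊2 * S⌋₊,
          χ (c : ZMod q) * ySummand b g q C D N' R S j σ d₀ w₀ v c m n r s := by
  unfold drappeauTwistedKlSum ySummand
  refine Finset.sum_congr rfl fun c _ => Finset.sum_congr rfl fun m _ =>
    Finset.sum_congr rfl fun n _ => Finset.sum_congr rfl fun r _ =>
      Finset.sum_congr rfl fun s _ => ?_
  split_ifs
  · ring
  · rw [mul_zero]

/-- **Support in `v`**: if `W_{v,j}(c,m,n,r,s) ≠ 0` with `S < s ≤ 2S`, then `1/4 < v < 2`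
(for `S, C, D > 0` and `g` supported in `C < c ≤ 2C`, `D < d ≤ 2D`). [folklore] -/
theorem v_bounds_of_weightW_ne_zero {g : ℝ → ℝ → ℝ → ℝ → ℝ → ℂ} {C D N' R S v : ℝ} {j : ℤ}
    (hC : 0 < C) (hD : 0 < D) (hS : 0 < S)
    (hsupp : ∀ c d n r s, g c d n r s ≠ 0 → C < c ∧ c ≤ 2 * C ∧ D < d ∧ d ≤ 2 * D)
    {c m n r s : ℝ} (hs1 : S < s) (hs2 : s ≤ 2 * S)
    (hW : weightW g C D N' R S v j c m n r s ≠ 0) : 1 / 4 < v ∧ v < 2 := by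
  unfold weightW at hW
  obtain ⟨_, h2⟩ := mul_ne_zero_iff.mp hW
  obtain ⟨hc1, hc2, hd1, hd2⟩ := hsupp _ _ _ _ _ h2
  have hSC : 0 < S * C := mul_pos hS hC
  have hs0 : 0 < s := hS.trans hs1
  have hc0 : 0 < c := hC.trans hc1
  have e : D / (S * C) * v * s * c = D * (v * (s * c) / (S * C)) := by
    field_simp
  rw [e] at hd1 hd2
  have h1 : 1 < v * (s * c) / (S * C) := (lt_mul_iff_one_lt_right hD).mp hd1
  have h2' : v * (s * c) / (S * C) ≤ 2 := le_of_mul_le_mul_left (by linarith) hD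
  rw [one_lt_div hSC] at h1
  rw [div_le_iff₀ hSC] at h2'
  have hsc : S * C < s * c := mul_lt_mul'' hs1 hc1 hS.le hC.le
  have hsc4 : s * c ≤ 4 * (S * C) := by nlinarith
  have hsc0 : 0 < s * c := mul_pos hs0 hc0
  constructor
  · by_contra hv
    rw [not_lt] at hv
    have : v * (s * c) ≤ 1 / 4 * (s * c) := mul_le_mul_of_nonneg_right hv hsc0.le
    nlinarith
  · by_contra hv
    rw [not_lt] at hv
    have : 2 * (s * c) ≤ v * (s * c) := mul_le_mul_of_nonneg_right hv hsc0.le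
    nlinarith

/-- `v ↦ W_{v,j}(c,m,n,r,s)` is continuous. [folklore] -/
theorem continuous_weightW_v {g : ℝ → ℝ → ℝ → ℝ → ℝ → ℂ} (hg : ContDiff ℝ ∞ (U5 g))
    (C D N' R S : ℝ) (j : ℤ) (c m n r s : ℝ) :
    Continuous fun v : ℝ => weightW g C D N' R S v j c m n r s := by
  unfold weightW
  refine continuous_const.mul ?_
  have h := (contDiff_slice_d hg c n r s).continuous
  exact h.comp (by fun_prop : Continuous fun v : ℝ => D / (S * C) * v * s * c)

/-- `v ↦ e(m t_v)` is continuous. [folklore] -/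
theorem continuous_phase (q : ℕ) (σ : ℤ) (d₀ w₀ : ℕ) (θ m : ℝ) :
    Continuous fun v : ℝ => (𝐞 (m * tPhase q σ d₀ w₀ θ v) : ℂ) := by
  have h1 : Continuous fun v : ℝ => m * tPhase q σ d₀ w₀ θ v := by
    unfold tPhase; fun_prop
  exact continuous_subtype_val.comp (Real.continuous_fourierChar.comp h1)

/-- **Integrability in `v`** of each summand (continuous with compact support). [folklore] -/
theorem integrable_ySummand {g : ℝ → ℝ → ℝ → ℝ → ℝ → ℂ} (hg : ContDiff ℝ ∞ (U5 g))
    {C D N' R S : ℝ} (hC : 0 < C) (hD : 0 < D) (hS : 0 < S)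
    (hsupp : ∀ c d n r s, g c d n r s ≠ 0 → C < c ∧ c ≤ 2 * C ∧ D < d ∧ d ≤ 2 * D)
    (b : ℕ → ℕ → ℕ → ℂ) (q : ℕ) (j σ : ℤ) (d₀ w₀ : ℕ) {c : ℕ} (m n r : ℕ) {s : ℕ}
    (hc : 0 < c) (hs : 0 < s) :
    Integrable (fun v : ℝ => ySummand b g q C D N' R S j σ d₀ w₀ v c m n r s) := by
  unfold ySummand
  by_cases hcop : Nat.Coprime (s * c) (r * q)
  · simp only [if_pos hcop]
    apply Continuous.integrable_of_hasCompactSupport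
    · exact ((continuous_const.mul (continuous_weightW_v hg C D N' R S j c m n r s)).mul
        (continuous_phase q σ d₀ w₀ (D / (S * C)) m)).mul continuous_const
    · refine HasCompactSupport.of_support_subset_isCompact
        (isCompact_Icc (a := (0 : ℝ)) (b := 2 * (S * C))) ?_
      intro v hv
      rw [Function.mem_support] at hv
      obtain ⟨h123, _⟩ := mul_ne_zero_iff.mp hv
      obtain ⟨h12, _⟩ := mul_ne_zero_iff.mp h123
      obtain ⟨_, hW⟩ := mul_ne_zero_iff.mp h12
      unfold weightW at hW
      obtain ⟨_, hg'⟩ := mul_ne_zero_iff.mp hW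
      obtain ⟨-, -, hd1, hd2⟩ := hsupp _ _ _ _ _ hg'
      have hSC : 0 < S * C := mul_pos hS hC
      have hsc1 : (1 : ℝ) ≤ (s : ℝ) * c := by
        have h1 : (1 : ℝ) ≤ s := by exact_mod_cast hs
        have h2 : (1 : ℝ) ≤ c := by exact_mod_cast hc
        nlinarith
      have e : D / (S * C) * v * s * c = D * (v * (s * c) / (S * C)) := by
        field_simp
      rw [e] at hd1 hd2
      have h1 : 1 < v * (s * c) / (S * C) := (lt_mul_iff_one_lt_right hD).mp hd1
      have h2' : v * (s * c) / (S * C) ≤ 2 := le_of_mul_le_mul_left (by linarith) hD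
      rw [one_lt_div hSC] at h1
      rw [div_le_iff₀ hSC] at h2'
      constructor
      · by_contra hv0
        rw [not_le] at hv0
        have : v * (s * c) ≤ 0 := mul_nonpos_of_nonpos_of_nonneg hv0.le (by positivity)
        linarith
      · by_contra hv2
        rw [not_le] at hv2
        have : 2 * (S * C) * 1 < v * (s * c) := by
          calc 2 * (S * C) * 1 < v * 1 := by linarith
            _ ≤ v * (s * c) := mul_le_mul_of_nonneg_left hsc1 (by linarith)
        linarith
  · simp only [if_neg hcop]
    exact integrable_zero _ _ _

/-- Unfolding `Y` on coprime indices. [folklore] -/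
theorem ySummand_of_coprime {b : ℕ → ℕ → ℕ → ℂ} {g : ℝ → ℝ → ℝ → ℝ → ℝ → ℂ} {q : ℕ}
    {C D N' R S : ℝ} {j σ : ℤ} {d₀ w₀ : ℕ} {v : ℝ} {c m n r s : ℕ}
    (h : Nat.Coprime (s * c) (r * q)) :
    ySummand b g q C D N' R S j σ d₀ w₀ v c m n r s =
      b n r s * weightW g C D N' R S v j c m n r s *
        (𝐞 ((m : ℝ) * tPhase q σ d₀ w₀ (D / (S * C)) v) : ℂ) *
          kl (s * c) r n (σ * m * ((((q : ZMod (s * c)))⁻¹).val : ℤ)) := by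
  unfold ySummand
  rw [if_pos h]

/-- `Y = 0` on non-coprime indices. [folklore] -/
theorem ySummand_of_not_coprime {b : ℕ → ℕ → ℕ → ℂ} {g : ℝ → ℝ → ℝ → ℝ → ℝ → ℂ} {q : ℕ}
    {C D N' R S : ℝ} {j σ : ℤ} {d₀ w₀ : ℕ} {v : ℝ} {c m n r s : ℕ}
    (h : ¬ Nat.Coprime (s * c) (r * q)) :
    ySummand b g q C D N' R S j σ d₀ w₀ v c m n r s = 0 := by
  unfold ySummand
  rw [if_neg h]

/-- **The analytic core of the `ℬ`-term** ([Dr, §4.3.3] with the substitution `x = θ s c v`,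
`θ = D/(SC)`): for `(c, n, r, s, h)` in the ranges,
`coefT · φ_j(h) Ψ_{c,n,r,s}(σh) = (θ/q) 1_{c ≡ c₀} ∫ Y(v) dv`, `Y` the character-free summand of
Prop. 4.13's sum for `W_{v,j}` and `t_v`. [cite: Drappeau2017, §4.3.3] -/
theorem termB_term_identity {g : ℝ → ℝ → ℝ → ℝ → ℝ → ℂ}
    {C D N' R S : ℝ} (hC : 0 < C) (hD : 0 < D) (hN' : 0 < N') (hR : 0 < R) (hS : 0 < S)
    {q : ℕ} (hq : 0 < q) (c₀ d₀ s₀ : ℕ) {b : ℕ → ℕ → ℕ → ℂ}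
    (hb : ∀ n r s : ℕ, b n r s ≠ 0 →
      (N' < n ∧ (n : ℝ) ≤ 2 * N' ∧ R < r ∧ (r : ℝ) ≤ 2 * R ∧ S < s ∧ (s : ℝ) ≤ 2 * S ∧
        s ≡ s₀ [MOD q]))
    (j σ : ℤ) {c : ℕ} (n r : ℕ) {s : ℕ} (h : ℕ) (hc : 0 < c) (hs : 0 < s) :
    coefT b q c₀ c n r s * (((sqrtTwoBump j h : ℝ) : ℂ) * psiT g q d₀ c n r s (σ * h)) =
      (((D / (S * C)) / q : ℝ) : ℂ) *
        (if c ≡ c₀ [MOD q] then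
          ∫ v : ℝ, ySummand b g q C D N' R S j σ d₀ (wInv q s₀ c₀) v c h n r s else 0) := by
  unfold coefT
  by_cases hcc : c ≡ c₀ [MOD q]
  swap
  · rw [if_neg (fun h' => hcc h'.1), if_neg hcc, zero_mul, mul_zero]
  rw [if_pos hcc]
  have hcopiff : Nat.Coprime (s * c) (r * q) ↔ Nat.Coprime (q * r) (s * c) := by
    rw [Nat.coprime_comm, mul_comm r q]
  by_cases hcop : Nat.Coprime (q * r) (s * c)
  swap
  · rw [if_neg (fun h' => hcop h'.2), zero_mul]
    have hc' : ¬ Nat.Coprime (s * c) (r * q) := fun h' => hcop (hcopiff.mp h')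
    have h0 : (fun v : ℝ => ySummand b g q C D N' R S j σ d₀ (wInv q s₀ c₀) v c h n r s) =
        fun _ => 0 := funext fun v => ySummand_of_not_coprime hc'
    rw [h0, integral_zero, mul_zero]
  have hcop' : Nat.Coprime (s * c) (r * q) := hcopiff.mpr hcop
  rw [if_pos ⟨hcc, hcop⟩]
  by_cases hb0 : b n r s = 0
  · have h0 : (fun v : ℝ => ySummand b g q C D N' R S j σ d₀ (wInv q s₀ c₀) v c h n r s) =
        fun _ => 0 := funext fun v => by rw [ySummand_of_coprime hcop', hb0]; simp
    rw [h0, integral_zero, mul_zero, hb0]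
    simp
  obtain ⟨hn1, hn2, hr1, hr2, hs1, hs2, hss⟩ := hb n r s hb0
  -- constants
  have hqR : (q : ℝ) ≠ 0 := by exact_mod_cast hq.ne'
  have hsR : (s : ℝ) ≠ 0 := by exact_mod_cast hs.ne'
  have hcR : (c : ℝ) ≠ 0 := by exact_mod_cast hc.ne'
  have hqC : (q : ℂ) ≠ 0 := by exact_mod_cast hq.ne'
  have hsCx : (s : ℂ) ≠ 0 := by exact_mod_cast hs.ne'
  have hcC : (c : ℂ) ≠ 0 := by exact_mod_cast hc.ne'
  have hSC : (S : ℂ) ≠ 0 := by exact_mod_cast hS.ne'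
  have hCC : (C : ℂ) ≠ 0 := by exact_mod_cast hC.ne'
  have hSR : (S : ℝ) ≠ 0 := hS.ne'
  have hCR : (C : ℝ) ≠ 0 := hC.ne'
  set a : ℝ := D / (S * C) * s * c with ha
  have ha0 : 0 < a := by positivity
  -- unfold `Ψ` and substitute `x = a v` in the Fourier integral
  unfold psiT
  set y : ℝ := ((σ * (h : ℤ) : ℤ) : ℝ) / ((q * (s * c) : ℕ) : ℝ) with hy
  have hay : a * y = D / (S * C) * (σ * h) / q := by
    rw [ha, hy]; push_cast; field_simp
  rw [fourier_eq_mul_integral_comp_mul _ ha0 y]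
  -- the weight on the support of `b`
  have hW : ∀ v : ℝ, weightW g C D N' R S v j c h n r s =
      ((sqrtTwoBump j h : ℝ) : ℂ) * g c (D / (S * C) * v * s * c) n r s := by
    intro v
    rw [weightW_eq_of_mem hN' hR hS ⟨hn1.le, hn2⟩ ⟨hr1.le, hr2⟩ ⟨hs1.le, hs2⟩]
  -- `w_{sc} = w₀`
  have hw : wInv q s c = wInv q s₀ c₀ := wInv_congr hss hcc
  -- the phase
  have hphase : ∀ v : ℝ, (𝐞 (-(v * (a * y))) : ℂ) *
      (𝐞 (((σ * (h : ℤ) : ℤ) : ℝ) * d₀ * ((wInv q s c : ℕ) : ℝ) / q) : ℂ) =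
      (𝐞 ((h : ℝ) * tPhase q σ d₀ (wInv q s₀ c₀) (D / (S * C)) v) : ℂ) := by
    intro v
    rw [← Circle.coe_mul, ← AddChar.map_add_eq_mul, hw, hay]
    congr 2
    unfold tPhase
    push_cast
    ring
  have hY : (fun v : ℝ => ySummand b g q C D N' R S j σ d₀ (wInv q s₀ c₀) v c h n r s) =
      fun v => (b n r s * ((sqrtTwoBump j h : ℝ) : ℂ) *
          kl (s * c) r n (σ * (h : ℤ) * ((((q : ZMod (s * c)))⁻¹).val : ℤ)) *
          (𝐞 (((σ * (h : ℤ) : ℤ) : ℝ) * d₀ * ((wInv q s c : ℕ) : ℝ) / q) : ℂ)) *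
        (𝐞 (-(v * (a * y))) • g c (a * v) n r s) := by
    funext v
    rw [ySummand_of_coprime hcop', hW v, ← hphase v, Circle.smul_def, smul_eq_mul,
      show D / (S * C) * v * s * c = a * v by rw [ha]; ring]
    ring
  rw [hY, integral_const_mul]
  have hqsc : (((q * (s * c) : ℕ) : ℂ))⁻¹ * (a : ℂ) = (((D / (S * C)) / q : ℝ) : ℂ) := by
    rw [ha]; push_cast; field_simp
  rw [← hqsc]
  ring

/-- **Character average** ([Dr, §4.3.3]: detecting `c ≡ c₀ (q)` by the characters modulo `q`):
`Σ_χ χ̄(c₀) ∫ 𝒮_χ(v) dv = φ(q) Σ_{c,m,n,r,s} 1_{c≡c₀} ∫ Y(v) dv`. [cite: Drappeau2017, §4.3.3] -/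
theorem sum_char_integral_eq {g : ℝ → ℝ → ℝ → ℝ → ℝ → ℂ} (hg : ContDiff ℝ ∞ (U5 g))
    {C D N' R S : ℝ} (hC : 0 < C) (hD : 0 < D) (hS : 0 < S)
    (hsupp : ∀ c d n r s, g c d n r s ≠ 0 → C < c ∧ c ≤ 2 * C ∧ D < d ∧ d ≤ 2 * D)
    {q : ℕ} [NeZero q] {c₀ : ℕ} (hc₀ : c₀.Coprime q) (d₀ w₀ : ℕ) (b : ℕ → ℕ → ℕ → ℂ)
    (j σ : ℤ) :
    ∑ χ : DirichletCharacter ℂ q, χ ((c₀ : ZMod q))⁻¹ *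
        ∫ v : ℝ, drappeauTwistedKlSum q χ (tPhase q σ d₀ w₀ (D / (S * C)) v) σ C
          (sqrtTwoScale j) N' R S b (weightW g C D N' R S v j) =
      (q.totient : ℂ) *
        ∑ c ∈ Icc 1 ⌊2 * C⌋₊, ∑ m ∈ Icc 1 ⌊2 * sqrtTwoScale j⌋₊, ∑ n ∈ Icc 1 ⌊2 * N'⌋₊,
          ∑ r ∈ Icc 1 ⌊2 * R⌋₊, ∑ s ∈ Icc 1 ⌊2 * S⌋₊,
            (if c ≡ c₀ [MOD q] then
              ∫ v : ℝ, ySummand b g q C D N' R S j σ d₀ w₀ v c m n r s else 0) := by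
  classical
  have hunit : IsUnit ((c₀ : ℕ) : ZMod q) := (ZMod.isUnit_iff_coprime c₀ q).mpr hc₀
  simp_rw [drappeauTwistedKlSum_weightW]
  have hI : ∀ χ : DirichletCharacter ℂ q,
      ∫ v : ℝ, ∑ c ∈ Icc 1 ⌊2 * C⌋₊, ∑ m ∈ Icc 1 ⌊2 * sqrtTwoScale j⌋₊,
        ∑ n ∈ Icc 1 ⌊2 * N'⌋₊, ∑ r ∈ Icc 1 ⌊2 * R⌋₊, ∑ s ∈ Icc 1 ⌊2 * S⌋₊,
          χ (c : ZMod q) * ySummand b g q C D N' R S j σ d₀ w₀ v c m n r s =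
      ∑ c ∈ Icc 1 ⌊2 * C⌋₊, ∑ m ∈ Icc 1 ⌊2 * sqrtTwoScale j⌋₊,
        ∑ n ∈ Icc 1 ⌊2 * N'⌋₊, ∑ r ∈ Icc 1 ⌊2 * R⌋₊, ∑ s ∈ Icc 1 ⌊2 * S⌋₊,
          χ (c : ZMod q) * ∫ v : ℝ, ySummand b g q C D N' R S j σ d₀ w₀ v c m n r s := by
    intro χ
    rw [integral_finset_sum5 _ _ _ _ _
      (fun (c : ℕ) (m : ℕ) (n : ℕ) (r : ℕ) (s : ℕ) (v : ℝ) =>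
        χ ((c : ℕ) : ZMod q) * ySummand b g q C D N' R S j σ d₀ w₀ v c m n r s)
      (fun c hc m _ n _ r _ s hs => (integrable_ySummand hg hC hD hS hsupp b q j σ d₀ w₀ m n r
        (Finset.mem_Icc.mp hc).1 (Finset.mem_Icc.mp hs).1).const_mul _)]
    simp_rw [integral_const_mul]
  simp_rw [hI, Finset.mul_sum]
  rw [sum_comm_in5]
  refine Finset.sum_congr rfl fun c _ => Finset.sum_congr rfl fun m _ =>
    Finset.sum_congr rfl fun n _ => Finset.sum_congr rfl fun r _ =>
      Finset.sum_congr rfl fun s _ => ?_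
  simp_rw [← mul_assoc]
  rw [← Finset.sum_mul, DirichletCharacter.sum_char_inv_mul_char_eq ℂ hunit]
  by_cases hcc : c ≡ c₀ [MOD q]
  · rw [if_pos hcc, if_pos ((ZMod.natCast_eq_natCast_iff _ _ _).mpr hcc.symm)]
  · rw [if_neg hcc, if_neg (fun h => hcc ((ZMod.natCast_eq_natCast_iff _ _ _).mp h).symm),
      zero_mul, mul_zero]

/-- **`ℬ_j^σ` as an average of Proposition 4.13 sums** ([Dr, §4.3.3, treatment of `ℬ`], with
the substitution `x = θ s c v`, `θ = D/(SC)`, instead of `ξ ↦ ξscq/m`): for coefficients `b`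
supported in `(N',2N'] × (R,2R] × (S,2S] ∩ {s ≡ s₀ (q)}` and `(c₀, q) = 1`,
`ℬ_j^σ = (θ/q) φ(q)⁻¹ Σ_χ χ̄(c₀) ∫ 𝒮_χ(t_v, σ, a_j; b, W_{v,j}) dv`. [cite: Drappeau2017, §4.3.3] -/
theorem termB_eq {g : ℝ → ℝ → ℝ → ℝ → ℝ → ℂ} (hg : ContDiff ℝ ∞ (U5 g))
    {C D N' R S : ℝ} (hC : 0 < C) (hD : 0 < D) (hN' : 0 < N') (hR : 0 < R) (hS : 0 < S)
    (hsupp : ∀ c d n r s, g c d n r s ≠ 0 → C < c ∧ c ≤ 2 * C ∧ D < d ∧ d ≤ 2 * D)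
    {q : ℕ} (hq : 0 < q) {c₀ : ℕ} (hc₀ : c₀.Coprime q) (d₀ s₀ : ℕ) {b : ℕ → ℕ → ℕ → ℂ}
    (hb : ∀ n r s : ℕ, b n r s ≠ 0 →
      (N' < n ∧ (n : ℝ) ≤ 2 * N' ∧ R < r ∧ (r : ℝ) ≤ 2 * R ∧ S < s ∧ (s : ℝ) ≤ 2 * S ∧
        s ≡ s₀ [MOD q]))
    (j σ : ℤ) :
    termB b g q c₀ d₀ C R S ⌊2 * N'⌋₊ j σ =
      (((D / (S * C)) / q : ℝ) : ℂ) * ((q.totient : ℂ))⁻¹ *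
        ∑ χ : DirichletCharacter ℂ q, χ ((c₀ : ZMod q))⁻¹ *
          ∫ v : ℝ, drappeauTwistedKlSum q χ (tPhase q σ d₀ (wInv q s₀ c₀) (D / (S * C)) v) σ C
            (sqrtTwoScale j) N' R S b (weightW g C D N' R S v j) := by
  haveI : NeZero q := ⟨hq.ne'⟩
  have hφ : (q.totient : ℂ) ≠ 0 := by exact_mod_cast (Nat.totient_pos.mpr hq).ne'
  rw [sum_char_integral_eq hg hC hD hS hsupp hc₀, mul_assoc, inv_mul_cancel_left₀ hφ]
  unfold termB
  simp_rw [Finset.mul_sum]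
  rw [Finset.sum_congr rfl fun c hc => Finset.sum_congr rfl fun n _ =>
    Finset.sum_congr rfl fun r _ => Finset.sum_congr rfl fun s hs =>
      Finset.sum_congr rfl fun h _ =>
        termB_term_identity hC hD hN' hR hS hq c₀ d₀ s₀ hb j σ n r h
          (Finset.mem_Icc.mp hc).1 (Finset.mem_Icc.mp hs).1]
  simp_rw [← Finset.mul_sum]
  congr 1
  refine Finset.sum_congr rfl fun c _ => ?_
  exact sum_comm_out3 _ _ _ _ _

/-- The number of Dirichlet characters modulo `q` is `φ(q)`. [folklore] -/
theorem card_dirichletCharacter (q : ℕ) [NeZero q] :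
    Fintype.card (DirichletCharacter ℂ q) = q.totient := by
  rw [← Nat.card_eq_fintype_card]
  exact DirichletCharacter.card_eq_totient_of_hasEnoughRootsOfUnity ℂ q

/-- **The `ℬ`-term bound** ([Dr, §4.3.3]): if Prop. 4.13's sum for `W_{v,j}`, `t_v`, `a_j`
is at most `Z` in absolute value for every character `χ` and every `v ∈ [1/4, 2]`, then
`|ℬ_j^σ| ≤ 2 (D/(SCq)) Z`. [cite: Drappeau2017, §4.3.3] -/
theorem norm_termB_le {g : ℝ → ℝ → ℝ → ℝ → ℝ → ℂ} (hg : ContDiff ℝ ∞ (U5 g))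
    {C D N' R S : ℝ} (hC : 0 < C) (hD : 0 < D) (hN' : 0 < N') (hR : 0 < R) (hS : 0 < S)
    (hsupp : ∀ c d n r s, g c d n r s ≠ 0 → C < c ∧ c ≤ 2 * C ∧ D < d ∧ d ≤ 2 * D)
    {q : ℕ} (hq : 0 < q) {c₀ : ℕ} (hc₀ : c₀.Coprime q) (d₀ s₀ : ℕ) {b : ℕ → ℕ → ℕ → ℂ}
    (hb : ∀ n r s : ℕ, b n r s ≠ 0 →
      (N' < n ∧ (n : ℝ) ≤ 2 * N' ∧ R < r ∧ (r : ℝ) ≤ 2 * R ∧ S < s ∧ (s : ℝ) ≤ 2 * S ∧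
        s ≡ s₀ [MOD q]))
    (j σ : ℤ) {Z : ℝ} (hZ0 : 0 ≤ Z)
    (hZ : ∀ χ : DirichletCharacter ℂ q, ∀ v : ℝ, 1 / 4 ≤ v → v ≤ 2 →
      ‖drappeauTwistedKlSum q χ (tPhase q σ d₀ (wInv q s₀ c₀) (D / (S * C)) v) σ C
          (sqrtTwoScale j) N' R S b (weightW g C D N' R S v j)‖ ≤ Z) :
    ‖termB b g q c₀ d₀ C R S ⌊2 * N'⌋₊ j σ‖ ≤ 2 * ((D / (S * C)) / q) * Z := by
  haveI : NeZero q := ⟨hq.ne'⟩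
  rw [termB_eq hg hC hD hN' hR hS hsupp hq hc₀ d₀ s₀ hb j σ]
  have hθ : 0 ≤ (D / (S * C)) / q := by positivity
  have hφpos : 0 < q.totient := Nat.totient_pos.mpr hq
  -- vanishing outside `[1/4, 2]`
  have hvan : ∀ χ : DirichletCharacter ℂ q, ∀ v : ℝ, v ∉ Set.Icc (1 / 4 : ℝ) 2 →
      drappeauTwistedKlSum q χ (tPhase q σ d₀ (wInv q s₀ c₀) (D / (S * C)) v) σ C
        (sqrtTwoScale j) N' R S b (weightW g C D N' R S v j) = 0 := by
    intro χ v hv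
    rw [drappeauTwistedKlSum_weightW]
    refine Finset.sum_eq_zero fun c _ => Finset.sum_eq_zero fun m _ =>
      Finset.sum_eq_zero fun n _ => Finset.sum_eq_zero fun r _ =>
        Finset.sum_eq_zero fun s _ => ?_
    unfold ySummand
    split_ifs with hcop
    · by_cases hb0 : b n r s = 0
      · simp [hb0]
      obtain ⟨-, -, -, -, hs1, hs2, -⟩ := hb n r s hb0
      have hW : weightW g C D N' R S v j c m n r s = 0 := by
        by_contra hW
        have := v_bounds_of_weightW_ne_zero hC hD hS hsupp hs1 hs2 hW
        exact hv ⟨this.1.le, this.2.le⟩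
      simp [hW]
    · simp
  have hint : ∀ χ : DirichletCharacter ℂ q,
      ‖∫ v : ℝ, drappeauTwistedKlSum q χ (tPhase q σ d₀ (wInv q s₀ c₀) (D / (S * C)) v) σ C
        (sqrtTwoScale j) N' R S b (weightW g C D N' R S v j)‖ ≤ Z * (7 / 4) := by
    intro χ
    rw [← setIntegral_eq_integral_of_forall_compl_eq_zero (fun v hv => hvan χ v hv)]
    have h := norm_setIntegral_le_of_norm_le_const (μ := volume) (s := Set.Icc (1 / 4 : ℝ) 2)
      (f := fun v => drappeauTwistedKlSum q χ (tPhase q σ d₀ (wInv q s₀ c₀) (D / (S * C)) v)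
        σ C (sqrtTwoScale j) N' R S b (weightW g C D N' R S v j)) (C := Z)
      measure_Icc_lt_top (fun v hv => hZ χ v hv.1 hv.2)
    rwa [Real.volume_real_Icc_of_le (by norm_num), show (2 : ℝ) - 1 / 4 = 7 / 4 by norm_num]
      at h
  have hsum : ‖∑ χ : DirichletCharacter ℂ q, χ ((c₀ : ZMod q))⁻¹ *
      ∫ v : ℝ, drappeauTwistedKlSum q χ (tPhase q σ d₀ (wInv q s₀ c₀) (D / (S * C)) v) σ C
        (sqrtTwoScale j) N' R S b (weightW g C D N' R S v j)‖ ≤ q.totient * (Z * (7 / 4)) := by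
    refine (norm_sum_le _ _).trans ?_
    have hterm : ∀ χ ∈ (Finset.univ : Finset (DirichletCharacter ℂ q)),
        ‖χ ((c₀ : ZMod q))⁻¹ *
          ∫ v : ℝ, drappeauTwistedKlSum q χ (tPhase q σ d₀ (wInv q s₀ c₀) (D / (S * C)) v) σ
            C (sqrtTwoScale j) N' R S b (weightW g C D N' R S v j)‖ ≤ Z * (7 / 4) := by
      intro χ _
      rw [norm_mul]
      calc _ ≤ 1 * (Z * (7 / 4)) :=
            mul_le_mul (χ.norm_le_one _) (hint χ) (norm_nonneg _) zero_le_one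
        _ = _ := one_mul _
    refine (Finset.sum_le_sum hterm).trans ?_
    rw [Finset.sum_const, Finset.card_univ, card_dirichletCharacter, nsmul_eq_mul]
  calc _ ≤ ‖(((D / (S * C)) / q : ℝ) : ℂ)‖ * ‖((q.totient : ℂ))⁻¹‖ *
        (q.totient * (Z * (7 / 4))) := by
        rw [norm_mul, norm_mul]
        exact mul_le_mul_of_nonneg_left hsum (by positivity)
    _ = (D / (S * C)) / q * (Z * (7 / 4)) := by
        rw [Complex.norm_real, Real.norm_of_nonneg hθ, norm_inv, Complex.norm_natCast]
        have : (q.totient : ℝ) ≠ 0 := by exact_mod_cast hφpos.ne'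
        field_simp
    _ ≤ 2 * ((D / (S * C)) / q) * Z := by nlinarith


/-! ### Cauchy–Schwarz over the `(n, r, s)`-box -/

/-- A triple sum as a sum over a product of finsets. [folklore] -/
theorem sum3_eq_sum_product (A B Cs : Finset ℕ) (F : ℕ → ℕ → ℕ → ℝ) :
    ∑ n ∈ A, ∑ r ∈ B, ∑ s ∈ Cs, F n r s = ∑ p ∈ A ×ˢ (B ×ˢ Cs), F p.1 p.2.1 p.2.2 := by
  simp only [Finset.sum_product]

/-- **Cauchy–Schwarz** for triple sums. [folklore] -/
theorem cauchy_schwarz_sum3 (A B Cs : Finset ℕ) (f g : ℕ → ℕ → ℕ → ℝ) :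
    ∑ n ∈ A, ∑ r ∈ B, ∑ s ∈ Cs, f n r s * g n r s ≤
      Real.sqrt (∑ n ∈ A, ∑ r ∈ B, ∑ s ∈ Cs, f n r s ^ 2) *
        Real.sqrt (∑ n ∈ A, ∑ r ∈ B, ∑ s ∈ Cs, g n r s ^ 2) := by
  rw [sum3_eq_sum_product, sum3_eq_sum_product, sum3_eq_sum_product]
  exact Real.sum_mul_le_sqrt_mul_sqrt _ _ _

/-- The `ℓ²`-norm of a block of coefficients over the box `[1,2N'] × [1,2R] × [1,2S]`.
[folklore] -/
def bNorm (b : ℕ → ℕ → ℕ → ℂ) (N' R S : ℝ) : ℝ :=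
  Real.sqrt (∑ n ∈ Icc 1 ⌊2 * N'⌋₊, ∑ r ∈ Icc 1 ⌊2 * R⌋₊, ∑ s ∈ Icc 1 ⌊2 * S⌋₊, ‖b n r s‖ ^ 2)

/-- `‖b‖₂ ≥ 0`. [folklore] -/
theorem bNorm_nonneg (b : ℕ → ℕ → ℕ → ℂ) (N' R S : ℝ) : 0 ≤ bNorm b N' R S :=
  Real.sqrt_nonneg _

/-! ### `𝒜₀`: the zero frequency (Ramanujan sums; the correction of [BFI3] / [ABL, §3.3]) -/

/-- `Ψ ≡ 0` when the slice `g(c,·,n,r,s)` vanishes identically. [folklore] -/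
theorem psiT_eq_zero_of_slice {g : ℝ → ℝ → ℝ → ℝ → ℝ → ℂ} {q d₀ c n r s : ℕ}
    (h0 : ∀ x : ℝ, g c x n r s = 0) (h : ℤ) : psiT g q d₀ c n r s h = 0 := by
  unfold psiT
  have : (fun x : ℝ => g c x n r s) = fun _ => 0 := funext h0
  rw [this, Real.fourier_real_eq]
  simp

/-- **The zero frequency, term by term** ([ABL, §3.3] / [BFI3]: `|S(0, n r̄; sc)| = |c_{sc}(n)| ≤ (n, sc)
≤ (n,s)(n,c)`): `|coefT · Ψ(0)| ≤ |b| (4DK₀/q) ((n,s)/s) · 1_{C<c} (n,c)/c`. [cite: AssingBlomerLi2020, §3.3] -/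
theorem norm_coefT_psiT_zero_le {g : ℝ → ℝ → ℝ → ℝ → ℝ → ℂ} (hg : ContDiff ℝ ∞ (U5 g))
    {C D : ℝ} (hD : 1 ≤ D)
    (hsupp : ∀ c d n r s, g c d n r s ≠ 0 → C < c ∧ c ≤ 2 * C ∧ D < d ∧ d ≤ 2 * D)
    {K₀ : ℝ} (hK₀ : 0 ≤ K₀) (hg0 : ∀ c d n r s, ‖g c d n r s‖ ≤ K₀)
    {q : ℕ} (hq : 0 < q) (c₀ d₀ : ℕ) (b : ℕ → ℕ → ℕ → ℂ) {c n : ℕ} (r : ℕ) {s : ℕ}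
    (hc : 0 < c) (hn : 0 < n) (hs : 0 < s) :
    ‖coefT b q c₀ c n r s * psiT g q d₀ c n r s 0‖ ≤
      ‖b n r s‖ * (4 * D * K₀ / q) * ((Nat.gcd n s : ℝ) / s) *
        (if C < (c : ℝ) then (Nat.gcd n c : ℝ) / c else 0) := by
  have hRHS0 : 0 ≤ ‖b n r s‖ * (4 * D * K₀ / q) * ((Nat.gcd n s : ℝ) / s) *
      (if C < (c : ℝ) then (Nat.gcd n c : ℝ) / c else 0) := by
    have : 0 ≤ (if C < (c : ℝ) then (Nat.gcd n c : ℝ) / c else 0) := by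
      split_ifs <;> positivity
    positivity
  unfold coefT
  by_cases hcond : c ≡ c₀ [MOD q] ∧ Nat.Coprime (q * r) (s * c)
  swap
  · rw [if_neg hcond, zero_mul, norm_zero]; exact hRHS0
  rw [if_pos hcond]
  obtain ⟨hcc, hcop⟩ := hcond
  by_cases hCc : C < (c : ℝ)
  swap
  · -- the slice vanishes identically
    have h0 : ∀ x : ℝ, g c x n r s = 0 := by
      intro x
      by_contra hx
      exact hCc (hsupp _ _ _ _ _ hx).1
    rw [psiT_eq_zero_of_slice h0, mul_zero, norm_zero]
    exact hRHS0
  rw [if_pos hCc]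
  haveI : NeZero (s * c) := ⟨(Nat.mul_pos hs hc).ne'⟩
  -- the three factors of `Ψ(0)`
  have hF0 : ‖𝓕 (fun x : ℝ => g c x n r s) (((0 : ℤ) : ℝ) / ((q * (s * c) : ℕ) : ℝ))‖ ≤
      2 * (2 * D) * K₀ := by
    rw [Int.cast_zero, zero_div]
    exact norm_fourier_zero_le (contDiff_slice_d hg _ _ _ _).continuous hD
      (fun x hx => ⟨(hsupp _ _ _ _ _ hx).2.2.1, (hsupp _ _ _ _ _ hx).2.2.2⟩)
      (fun x => hg0 _ _ _ _ _)
  have hkl : ‖kl (s * c) r n ((0 : ℤ) * ((((q : ZMod (s * c)))⁻¹).val : ℤ))‖ ≤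
      (Nat.gcd n s : ℝ) * Nat.gcd n c := by
    rw [zero_mul, kl_eq_kloostermanSum (Nat.Coprime.coprime_mul_left hcop), Int.cast_zero,
      Int.cast_natCast]
    refine (norm_kloostermanSum_zero_mul_inv_le (Nat.Coprime.coprime_mul_left hcop) n).trans ?_
    exact_mod_cast gcd_mul_right_le hn.ne' s c
  have he : ‖((𝐞 (((0 : ℤ) : ℝ) * d₀ * ((wInv q s c : ℕ) : ℝ) / q) : ℂ))‖ = 1 :=
    Circle.norm_coe _
  unfold psiT
  rw [norm_mul, norm_mul, norm_mul, norm_mul, he, one_mul, norm_inv, Complex.norm_natCast]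
  have hqsc : (0 : ℝ) < ((q * (s * c) : ℕ) : ℝ) := by positivity
  calc ‖b n r s‖ * (((q * (s * c) : ℕ) : ℝ))⁻¹ *
        (‖𝓕 (fun x : ℝ => g c x n r s) (((0 : ℤ) : ℝ) / ((q * (s * c) : ℕ) : ℝ))‖ *
          ‖kl (s * c) r n ((0 : ℤ) * ((((q : ZMod (s * c)))⁻¹).val : ℤ))‖)
      ≤ ‖b n r s‖ * (((q * (s * c) : ℕ) : ℝ))⁻¹ *
          ((2 * (2 * D) * K₀) * ((Nat.gcd n s : ℝ) * Nat.gcd n c)) := by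
        refine mul_le_mul_of_nonneg_left ?_ (by positivity)
        exact mul_le_mul hF0 hkl (norm_nonneg _) (by positivity)
    _ = ‖b n r s‖ * (4 * D * K₀ / q) * ((Nat.gcd n s : ℝ) / s) * ((Nat.gcd n c : ℝ) / c) := by
        have hq' : (q : ℝ) ≠ 0 := by exact_mod_cast hq.ne'
        have hs' : (s : ℝ) ≠ 0 := by exact_mod_cast hs.ne'
        have hc' : (c : ℝ) ≠ 0 := by exact_mod_cast hc.ne'
        push_cast
        field_simp
        ring

/-- **The `𝒜₀` bound** ([ABL, §3.3], [BFI3]): with `T ≥ τ(n)` on the `n`-range and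
`|g| ≤ K₀`, `|𝒜₀| ≤ 32 D K₀ T √T √(N'R) ‖b‖₂ / q` (for `b` supported in `s > S`).
[cite: AssingBlomerLi2020, §3.3] -/
theorem norm_termA0_le {g : ℝ → ℝ → ℝ → ℝ → ℝ → ℂ} (hg : ContDiff ℝ ∞ (U5 g))
    {C D N' R S : ℝ} (hC : 1 ≤ C) (hD : 1 ≤ D) (hN' : 0 < N') (hR : 0 < R) (hS : 1 ≤ S)
    (hsupp : ∀ c d n r s, g c d n r s ≠ 0 → C < c ∧ c ≤ 2 * C ∧ D < d ∧ d ≤ 2 * D)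
    {K₀ : ℝ} (hK₀ : 0 ≤ K₀) (hg0 : ∀ c d n r s, ‖g c d n r s‖ ≤ K₀)
    {q : ℕ} (hq : 0 < q) (c₀ d₀ : ℕ) {b : ℕ → ℕ → ℕ → ℂ}
    (hb : ∀ n r s : ℕ, b n r s ≠ 0 → S < s)
    {T : ℝ} (hT1 : 1 ≤ T) (hT : ∀ n ∈ Icc 1 ⌊2 * N'⌋₊, (#n.divisors : ℝ) ≤ T) :
    ‖termA0 b g q c₀ d₀ C R S ⌊2 * N'⌋₊‖ ≤
      32 * D * K₀ * T * Real.sqrt T * Real.sqrt (N' * R) / q * bNorm b N' R S := by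
  have hq0 : (0 : ℝ) < q := by exact_mod_cast hq
  have hS0 : 0 < S := by linarith
  set A := Icc 1 ⌊2 * N'⌋₊ with hA
  set B := Icc 1 ⌊2 * R⌋₊ with hB
  set Cs := Icc 1 ⌊2 * S⌋₊ with hCs
  set Cc := Icc 1 ⌊2 * C⌋₊ with hCc
  -- Step 1: termwise
  have step1 : ‖termA0 b g q c₀ d₀ C R S ⌊2 * N'⌋₊‖ ≤
      ∑ c ∈ Cc, ∑ n ∈ A, ∑ r ∈ B, ∑ s ∈ Cs,
        ‖b n r s‖ * (4 * D * K₀ / q) * ((Nat.gcd n s : ℝ) / s) *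
          (if C < (c : ℝ) then (Nat.gcd n c : ℝ) / c else 0) := by
    unfold termA0
    refine (norm_sum_le _ _).trans (Finset.sum_le_sum fun c hc => ?_)
    refine (norm_sum_le _ _).trans (Finset.sum_le_sum fun n hn => ?_)
    refine (norm_sum_le _ _).trans (Finset.sum_le_sum fun r _ => ?_)
    refine (norm_sum_le _ _).trans (Finset.sum_le_sum fun s hs => ?_)
    exact norm_coefT_psiT_zero_le hg hD hsupp hK₀ hg0 hq c₀ d₀ b r (Finset.mem_Icc.mp hc).1
      (Finset.mem_Icc.mp hn).1 (Finset.mem_Icc.mp hs).1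
  -- Step 2: the `c`-sum
  have step2 : ∀ n ∈ A, ∑ c ∈ Cc, (if C < (c : ℝ) then (Nat.gcd n c : ℝ) / c else 0) ≤ 2 * T := by
    intro n hn
    have hn0 : n ≠ 0 := by have := (Finset.mem_Icc.mp hn).1; omega
    rw [← Finset.sum_filter]
    exact (sum_gcd_div_le hn0 hC).trans (by nlinarith [hT n hn])
  -- Step 3: reorganise and bound the `c`-sum
  have step3 : ∑ c ∈ Cc, ∑ n ∈ A, ∑ r ∈ B, ∑ s ∈ Cs,
        ‖b n r s‖ * (4 * D * K₀ / q) * ((Nat.gcd n s : ℝ) / s) *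
          (if C < (c : ℝ) then (Nat.gcd n c : ℝ) / c else 0) ≤
      ∑ n ∈ A, ∑ r ∈ B, ∑ s ∈ Cs, ‖b n r s‖ * (8 * D * K₀ * T / (q * S)) * (Nat.gcd n s : ℝ) := by
    rw [Finset.sum_comm]
    refine Finset.sum_le_sum fun n hn => ?_
    rw [Finset.sum_comm]
    refine Finset.sum_le_sum fun r _ => ?_
    rw [Finset.sum_comm]
    refine Finset.sum_le_sum fun s hs => ?_
    rw [← Finset.mul_sum]
    have hs0 : (0 : ℝ) < s := by exact_mod_cast (Finset.mem_Icc.mp hs).1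
    by_cases hb0 : b n r s = 0
    · simp [hb0]
    have hSs : S < s := hb n r s hb0
    have h2 := step2 n hn
    have hgcd : (0 : ℝ) ≤ Nat.gcd n s := Nat.cast_nonneg _
    -- `|b| (4DK₀/q) (g/s) Σ ≤ |b| (4DK₀/q) (g/S) 2T`
    calc ‖b n r s‖ * (4 * D * K₀ / q) * ((Nat.gcd n s : ℝ) / s) *
          ∑ c ∈ Cc, (if C < (c : ℝ) then (Nat.gcd n c : ℝ) / c else 0)
        ≤ ‖b n r s‖ * (4 * D * K₀ / q) * ((Nat.gcd n s : ℝ) / S) * (2 * T) := by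
          refine mul_le_mul ?_ h2 (Finset.sum_nonneg fun c _ => by split_ifs <;> positivity)
            (by positivity)
          refine mul_le_mul_of_nonneg_left ?_ (by positivity)
          exact div_le_div_of_nonneg_left hgcd hS0 hSs.le
      _ = ‖b n r s‖ * (8 * D * K₀ * T / (q * S)) * (Nat.gcd n s : ℝ) := by
          field_simp
          ring
  -- Step 4: Cauchy–Schwarz
  have step4 : ∑ n ∈ A, ∑ r ∈ B, ∑ s ∈ Cs, ‖b n r s‖ * (8 * D * K₀ * T / (q * S)) * (Nat.gcd n s : ℝ)
      ≤ (8 * D * K₀ * T / (q * S)) * (bNorm b N' R S *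
          Real.sqrt (∑ n ∈ A, ∑ r ∈ B, ∑ s ∈ Cs, (Nat.gcd n s : ℝ) ^ 2)) := by
    have e : ∑ n ∈ A, ∑ r ∈ B, ∑ s ∈ Cs, ‖b n r s‖ * (8 * D * K₀ * T / (q * S)) * (Nat.gcd n s : ℝ)
        = (8 * D * K₀ * T / (q * S)) * ∑ n ∈ A, ∑ r ∈ B, ∑ s ∈ Cs, ‖b n r s‖ * (Nat.gcd n s : ℝ) := by
      rw [Finset.mul_sum]
      refine Finset.sum_congr rfl fun n _ => ?_
      rw [Finset.mul_sum]
      refine Finset.sum_congr rfl fun r _ => ?_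
      rw [Finset.mul_sum]
      refine Finset.sum_congr rfl fun s _ => ?_
      ring
    rw [e]
    refine mul_le_mul_of_nonneg_left ?_ (by positivity)
    exact cauchy_schwarz_sum3 A B Cs (fun n r s => ‖b n r s‖) (fun n r s => (Nat.gcd n s : ℝ))
  -- Step 5: the gcd-square sum
  have step5 : ∑ n ∈ A, ∑ r ∈ B, ∑ s ∈ Cs, (Nat.gcd n s : ℝ) ^ 2 ≤ 16 * (N' * R) * S ^ 2 * T := by
    have h1 : ∀ n ∈ A, ∑ s ∈ Cs, (Nat.gcd n s : ℝ) ^ 2 ≤ T * (2 * S) ^ 2 := by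
      intro n hn
      have hn0 : n ≠ 0 := by have := (Finset.mem_Icc.mp hn).1; omega
      refine (sum_gcd_sq_le hn0 _).trans ?_
      have hfl : ((⌊2 * S⌋₊ : ℕ) : ℝ) ≤ 2 * S := Nat.floor_le (by linarith)
      have hfl0 : (0 : ℝ) ≤ ((⌊2 * S⌋₊ : ℕ) : ℝ) := Nat.cast_nonneg _
      exact mul_le_mul (hT n hn) (pow_le_pow_left₀ hfl0 hfl 2) (by positivity) (by linarith)
    calc ∑ n ∈ A, ∑ r ∈ B, ∑ s ∈ Cs, (Nat.gcd n s : ℝ) ^ 2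
        ≤ ∑ n ∈ A, ∑ r ∈ B, T * (2 * S) ^ 2 :=
          Finset.sum_le_sum fun n hn => Finset.sum_le_sum fun r _ => h1 n hn
      _ = (#A : ℝ) * (#B * (T * (2 * S) ^ 2)) := by
          rw [Finset.sum_const, Finset.sum_const, nsmul_eq_mul, nsmul_eq_mul]
      _ ≤ (2 * N') * ((2 * R) * (T * (2 * S) ^ 2)) := by
          have hA' : (#A : ℝ) ≤ 2 * N' := by
            rw [hA, Nat.card_Icc, Nat.add_sub_cancel]
            exact Nat.floor_le (by linarith)
          have hB' : (#B : ℝ) ≤ 2 * R := by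
            rw [hB, Nat.card_Icc, Nat.add_sub_cancel]
            exact Nat.floor_le (by linarith)
          have hT0 : 0 ≤ T * (2 * S) ^ 2 := by positivity
          exact mul_le_mul hA' (mul_le_mul_of_nonneg_right hB' hT0) (by positivity) (by linarith)
      _ = 16 * (N' * R) * S ^ 2 * T := by ring
  -- Step 6: assemble
  have hsq : Real.sqrt (∑ n ∈ A, ∑ r ∈ B, ∑ s ∈ Cs, (Nat.gcd n s : ℝ) ^ 2) ≤
      4 * S * Real.sqrt T * Real.sqrt (N' * R) := by
    refine (Real.sqrt_le_sqrt step5).trans (le_of_eq ?_)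
    rw [show 16 * (N' * R) * S ^ 2 * T = (4 * S) ^ 2 * (T * (N' * R)) by ring,
      Real.sqrt_mul (by positivity), Real.sqrt_sq (by linarith),
      Real.sqrt_mul (by linarith)]
    ring
  calc ‖termA0 b g q c₀ d₀ C R S ⌊2 * N'⌋₊‖
      ≤ (8 * D * K₀ * T / (q * S)) * (bNorm b N' R S *
          Real.sqrt (∑ n ∈ A, ∑ r ∈ B, ∑ s ∈ Cs, (Nat.gcd n s : ℝ) ^ 2)) :=
        step1.trans (step3.trans step4)
    _ ≤ (8 * D * K₀ * T / (q * S)) * (bNorm b N' R S * (4 * S * Real.sqrt T * Real.sqrt (N' * R))) := by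
        refine mul_le_mul_of_nonneg_left ?_ (by positivity)
        exact mul_le_mul_of_nonneg_left hsq (bNorm_nonneg _ _ _ _)
    _ = 32 * D * K₀ * T * Real.sqrt T * Real.sqrt (N' * R) / q * bNorm b N' R S := by
        field_simp
        ring

/-! ### `𝒜_∞`: beyond the smooth cut (Fourier decay, [Dr, §4.3.3]) -/

/-- **The tail, term by term**: for `J ≥ -1` and `k ≥ 2`,
`|coefT · Σ_h θ_{J+1}(|h|) Ψ(h)| ≤ |b| · 16 D K_k (D^{-k})^{1-ε₀} (q s c/(2π))^k ⌊a_{J+1}⌋₊^{1-k} / q`.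
[cite: Drappeau2017, §4.3.3] -/
theorem norm_coefT_tail_le {g : ℝ → ℝ → ℝ → ℝ → ℝ → ℂ} (hg : ContDiff ℝ ∞ (U5 g))
    {C D : ℝ} (hD : 1 ≤ D)
    (hsupp : ∀ c d n r s, g c d n r s ≠ 0 → C < c ∧ c ≤ 2 * C ∧ D < d ∧ d ≤ 2 * D)
    {k : ℕ} (hk : 2 ≤ k) {Kk ε₀ : ℝ} (hKk : 0 ≤ Kk) (hε₁ : ε₀ ≤ 1)
    (hderk : ∀ (c n r s : ℕ) (x : ℝ), 0 < x →
      ‖iteratedDeriv k (fun d : ℝ => g c d n r s) x‖ ≤ Kk * (x ^ (-(k : ℝ))) ^ (1 - ε₀))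
    {q : ℕ} (hq : 0 < q) (c₀ d₀ : ℕ) (b : ℕ → ℕ → ℕ → ℂ) {J : ℤ} (hJ : -1 ≤ J)
    {c : ℕ} (n r : ℕ) {s : ℕ} (hc : 0 < c) (hs : 0 < s) :
    ‖coefT b q c₀ c n r s *
        ∑' h : ℤ, ((sqrtTwoStep (J + 1) |(h : ℝ)| : ℝ) : ℂ) * psiT g q d₀ c n r s h‖ ≤
      ‖b n r s‖ * (16 * D * Kk * (D ^ (-(k : ℝ))) ^ (1 - ε₀) / q *
        ((((q * (s * c) : ℕ) : ℝ) / (2 * π)) ^ k * (((⌊sqrtTwoScale (J + 1)⌋₊ : ℝ) ^ (k - 1))⁻¹))) := by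
  have hD0 : 0 < D := by linarith
  have hpow0 : 0 ≤ (D ^ (-(k : ℝ))) ^ (1 - ε₀) := Real.rpow_nonneg (Real.rpow_nonneg hD0.le _) _
  have hRHS0 : 0 ≤ ‖b n r s‖ * (16 * D * Kk * (D ^ (-(k : ℝ))) ^ (1 - ε₀) / q *
      ((((q * (s * c) : ℕ) : ℝ) / (2 * π)) ^ k * (((⌊sqrtTwoScale (J + 1)⌋₊ : ℝ) ^ (k - 1))⁻¹))) := by
    positivity
  unfold coefT
  split_ifs with hcond
  swap
  · rw [zero_mul, norm_zero]; exact hRHS0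
  obtain ⟨_, hcop⟩ := hcond
  haveI : NeZero (s * c) := ⟨(Nat.mul_pos hs hc).ne'⟩
  -- the slice
  have hFcd : ContDiff ℝ ∞ (fun x : ℝ => g c x n r s) := contDiff_slice_d hg _ _ _ _
  have hFc := hasCompactSupport_slice hsupp (c : ℝ) n r s
  have hFsupp : ∀ x, (fun x : ℝ => g c x n r s) x ≠ 0 → D < x ∧ x ≤ 2 * D :=
    fun x hx => ⟨(hsupp _ _ _ _ _ hx).2.2.1, (hsupp _ _ _ _ _ hx).2.2.2⟩
  have hint := (slice_iteratedDeriv_bounds hFcd hD hFsupp hε₁ (hderk c n r s)).2.2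
  -- the weights `w(h) = θ_{J+1}(|h|) e(…) kl(…)`
  set d : ℝ := ((q * (s * c) : ℕ) : ℝ) with hd
  have hd0 : 0 < d := by rw [hd]; positivity
  set w : ℤ → ℂ := fun h => ((sqrtTwoStep (J + 1) |(h : ℝ)| : ℝ) : ℂ) *
    (((𝐞 ((h : ℝ) * d₀ * ((wInv q s c : ℕ) : ℝ) / q) : ℂ) *
      kl (s * c) r n (h * ((((q : ZMod (s * c)))⁻¹).val : ℤ)))) with hw
  have htsum : ∑' h : ℤ, ((sqrtTwoStep (J + 1) |(h : ℝ)| : ℝ) : ℂ) * psiT g q d₀ c n r s h =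
      ∑' h : ℤ, 𝓕 (fun x : ℝ => g c x n r s) ((h : ℝ) / d) * w h := by
    refine tsum_congr fun h => ?_
    simp only [psiT, hw, hd]
    ring
  have hwb : ∀ h, ‖w h‖ ≤ (s * c : ℕ) := by
    intro h
    simp only [hw]
    rw [norm_mul, norm_mul, Circle.norm_coe, one_mul, Complex.norm_real, Real.norm_eq_abs,
      abs_of_nonneg (sqrtTwoStep_mem_Icc _ _).1]
    calc sqrtTwoStep (J + 1) |(h : ℝ)| * ‖kl (s * c) r n (h * ((((q : ZMod (s * c)))⁻¹).val : ℤ))‖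
        ≤ 1 * (s * c : ℕ) := mul_le_mul (sqrtTwoStep_mem_Icc _ _).2 (norm_kl_le _ _ _ _)
          (norm_nonneg _) zero_le_one
      _ = _ := one_mul _
  have hK1 : 1 ≤ ⌊sqrtTwoScale (J + 1)⌋₊ := by
    refine Nat.le_floor ?_
    have : sqrtTwoScale 0 ≤ sqrtTwoScale (J + 1) := sqrtTwoScale_mono (by omega)
    rw [sqrtTwoScale_zero] at this
    exact_mod_cast this
  have hw0 : ∀ h : ℤ, h.natAbs ≤ ⌊sqrtTwoScale (J + 1)⌋₊ → w h = 0 := by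
    intro h hh
    simp only [hw]
    have habs : |(h : ℝ)| ≤ sqrtTwoScale (J + 1) := by
      have e : ((h.natAbs : ℕ) : ℝ) = |(h : ℝ)| := by rw [Nat.cast_natAbs, Int.cast_abs]
      rw [← e]
      exact le_trans (by exact_mod_cast hh) (Nat.floor_le (sqrtTwoScale_pos _).le)
    rw [sqrtTwoStep_of_le habs]
    simp
  have htail := norm_tsum_fourier_mul_le_of_vanish hFcd hFc hk hd0 hK1 (Nat.cast_nonneg _) hwb hw0
  -- assemble
  rw [norm_mul, norm_mul, norm_inv, Complex.norm_natCast, htsum]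
  calc ‖b n r s‖ * (((q * (s * c) : ℕ) : ℝ))⁻¹ *
        ‖∑' h : ℤ, 𝓕 (fun x : ℝ => g c x n r s) ((h : ℝ) / d) * w h‖
      ≤ ‖b n r s‖ * (((q * (s * c) : ℕ) : ℝ))⁻¹ * (((s * c : ℕ) : ℝ) *
          (4 * (∫ t, ‖iteratedDeriv k (fun x : ℝ => g c x n r s) t‖) * (d / (2 * π)) ^ k *
            (((⌊sqrtTwoScale (J + 1)⌋₊ : ℝ) ^ (k - 1))⁻¹))) :=
        mul_le_mul_of_nonneg_left htail (by positivity)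
    _ ≤ ‖b n r s‖ * (((q * (s * c) : ℕ) : ℝ))⁻¹ * (((s * c : ℕ) : ℝ) *
          (4 * (2 * (2 * D) * (Kk * (D ^ (-(k : ℝ))) ^ (1 - ε₀))) * (d / (2 * π)) ^ k *
            (((⌊sqrtTwoScale (J + 1)⌋₊ : ℝ) ^ (k - 1))⁻¹))) := by
        gcongr
    _ = _ := by
        have hq' : (q : ℝ) ≠ 0 := by exact_mod_cast hq.ne'
        have hs' : (s : ℝ) ≠ 0 := by exact_mod_cast hs.ne'
        have hc' : (c : ℝ) ≠ 0 := by exact_mod_cast hc.ne'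
        rw [hd]
        push_cast
        field_simp
        ring

/-- **The `𝒜_∞` bound** ([Dr, §4.3.3]): with `K = ⌊a_{J+1}⌋₊`,
`|𝒜_∞| ≤ 2C · 16 D K_k (D^{-k})^{1-ε₀} q^{k-1} (4SC/(2π))^k K^{1-k} · √(8N'RS) ‖b‖₂`.
[cite: Drappeau2017, §4.3.3] -/
theorem norm_termAinf_le {g : ℝ → ℝ → ℝ → ℝ → ℝ → ℂ} (hg : ContDiff ℝ ∞ (U5 g))
    {C D N' R S : ℝ} (hC : 1 ≤ C) (hD : 1 ≤ D) (hN' : 0 < N') (hR : 0 < R) (hS : 1 ≤ S)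
    (hsupp : ∀ c d n r s, g c d n r s ≠ 0 → C < c ∧ c ≤ 2 * C ∧ D < d ∧ d ≤ 2 * D)
    {k : ℕ} (hk : 2 ≤ k) {Kk ε₀ : ℝ} (hKk : 0 ≤ Kk) (hε₁ : ε₀ ≤ 1)
    (hderk : ∀ (c n r s : ℕ) (x : ℝ), 0 < x →
      ‖iteratedDeriv k (fun d : ℝ => g c d n r s) x‖ ≤ Kk * (x ^ (-(k : ℝ))) ^ (1 - ε₀))
    {q : ℕ} (hq : 0 < q) (c₀ d₀ : ℕ) (b : ℕ → ℕ → ℕ → ℂ) {J : ℤ} (hJ : -1 ≤ J) :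
    ‖termAinf b g q c₀ d₀ C R S ⌊2 * N'⌋₊ J‖ ≤
      2 * C * (16 * D * Kk * (D ^ (-(k : ℝ))) ^ (1 - ε₀) / q *
        (((q : ℝ) * (4 * S * C) / (2 * π)) ^ k * (((⌊sqrtTwoScale (J + 1)⌋₊ : ℝ) ^ (k - 1))⁻¹))) *
        (Real.sqrt (8 * N' * R * S) * bNorm b N' R S) := by
  have hD0 : 0 < D := by linarith
  have hC0 : 0 < C := by linarith
  have hS0 : 0 < S := by linarith
  have hq0 : (0 : ℝ) < q := by exact_mod_cast hq
  have hpow0 : 0 ≤ (D ^ (-(k : ℝ))) ^ (1 - ε₀) := Real.rpow_nonneg (Real.rpow_nonneg hD0.le _) _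
  set A := Icc 1 ⌊2 * N'⌋₊ with hA
  set B := Icc 1 ⌊2 * R⌋₊ with hB
  set Cs := Icc 1 ⌊2 * S⌋₊ with hCs
  set Cc := Icc 1 ⌊2 * C⌋₊ with hCc
  set L : ℝ := 16 * D * Kk * (D ^ (-(k : ℝ))) ^ (1 - ε₀) / q *
    (((q : ℝ) * (4 * S * C) / (2 * π)) ^ k * (((⌊sqrtTwoScale (J + 1)⌋₊ : ℝ) ^ (k - 1))⁻¹)) with hL
  have hL0 : 0 ≤ L := by positivity
  -- termwise, with `s c ≤ 4 S C`
  have step1 : ‖termAinf b g q c₀ d₀ C R S ⌊2 * N'⌋₊ J‖ ≤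
      ∑ c ∈ Cc, ∑ n ∈ A, ∑ r ∈ B, ∑ s ∈ Cs, ‖b n r s‖ * L := by
    unfold termAinf
    refine (norm_sum_le _ _).trans (Finset.sum_le_sum fun c hc => ?_)
    refine (norm_sum_le _ _).trans (Finset.sum_le_sum fun n _ => ?_)
    refine (norm_sum_le _ _).trans (Finset.sum_le_sum fun r _ => ?_)
    refine (norm_sum_le _ _).trans (Finset.sum_le_sum fun s hs => ?_)
    have hc1 := (Finset.mem_Icc.mp hc).1
    have hs1 := (Finset.mem_Icc.mp hs).1
    refine (norm_coefT_tail_le hg hD hsupp hk hKk hε₁ hderk hq c₀ d₀ b hJ n r hc1 hs1).trans ?_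
    refine mul_le_mul_of_nonneg_left ?_ (norm_nonneg _)
    rw [hL]
    refine mul_le_mul_of_nonneg_left ?_ (by positivity)
    refine mul_le_mul_of_nonneg_right ?_ (by positivity)
    refine pow_le_pow_left₀ (by positivity) ?_ k
    refine div_le_div_of_nonneg_right ?_ (by positivity)
    have hc2 : (c : ℝ) ≤ 2 * C := by
      have := (Finset.mem_Icc.mp hc).2
      exact le_trans (by exact_mod_cast this) (Nat.floor_le (by linarith))
    have hs2 : (s : ℝ) ≤ 2 * S := by
      have := (Finset.mem_Icc.mp hs).2
      exact le_trans (by exact_mod_cast this) (Nat.floor_le (by linarith))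
    have hs0' : (0 : ℝ) ≤ s := Nat.cast_nonneg _
    push_cast
    nlinarith [mul_le_mul hs2 hc2 (Nat.cast_nonneg c) (by linarith)]
  -- count and Cauchy–Schwarz
  have step2 : ∑ c ∈ Cc, ∑ n ∈ A, ∑ r ∈ B, ∑ s ∈ Cs, ‖b n r s‖ * L =
      (#Cc : ℝ) * (L * ∑ n ∈ A, ∑ r ∈ B, ∑ s ∈ Cs, ‖b n r s‖ * 1) := by
    rw [Finset.sum_const, nsmul_eq_mul]
    congr 1
    rw [Finset.mul_sum]
    refine Finset.sum_congr rfl fun n _ => ?_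
    rw [Finset.mul_sum]
    refine Finset.sum_congr rfl fun r _ => ?_
    rw [Finset.mul_sum]
    refine Finset.sum_congr rfl fun s _ => ?_
    ring
  have step3 : ∑ n ∈ A, ∑ r ∈ B, ∑ s ∈ Cs, ‖b n r s‖ * 1 ≤
      bNorm b N' R S * Real.sqrt (8 * N' * R * S) := by
    refine (cauchy_schwarz_sum3 A B Cs (fun n r s => ‖b n r s‖) (fun _ _ _ => (1 : ℝ))).trans ?_
    refine mul_le_mul_of_nonneg_left (Real.sqrt_le_sqrt ?_) (bNorm_nonneg _ _ _ _)
    simp only [one_pow, Finset.sum_const, nsmul_eq_mul, mul_one]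
    have hA' : (#A : ℝ) ≤ 2 * N' := by
      rw [hA, Nat.card_Icc, Nat.add_sub_cancel]
      exact Nat.floor_le (by linarith)
    have hB' : (#B : ℝ) ≤ 2 * R := by
      rw [hB, Nat.card_Icc, Nat.add_sub_cancel]
      exact Nat.floor_le (by linarith)
    have hCs' : (#Cs : ℝ) ≤ 2 * S := by
      rw [hCs, Nat.card_Icc, Nat.add_sub_cancel]
      exact Nat.floor_le (by linarith)
    calc (#A : ℝ) * ((#B : ℝ) * (#Cs : ℝ)) ≤ (2 * N') * ((2 * R) * (2 * S)) := by
          refine mul_le_mul hA' (mul_le_mul hB' hCs' (Nat.cast_nonneg _) (by linarith))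
            (by positivity) (by linarith)
      _ = 8 * N' * R * S := by ring
  have hCc' : (#Cc : ℝ) ≤ 2 * C := by
    rw [hCc, Nat.card_Icc, Nat.add_sub_cancel]
    exact Nat.floor_le (by linarith)
  calc ‖termAinf b g q c₀ d₀ C R S ⌊2 * N'⌋₊ J‖
      ≤ (#Cc : ℝ) * (L * ∑ n ∈ A, ∑ r ∈ B, ∑ s ∈ Cs, ‖b n r s‖ * 1) := step1.trans_eq step2
    _ ≤ (2 * C) * (L * (bNorm b N' R S * Real.sqrt (8 * N' * R * S))) := by
        refine mul_le_mul hCc' (mul_le_mul_of_nonneg_left step3 hL0) (by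
          have : 0 ≤ ∑ n ∈ A, ∑ r ∈ B, ∑ s ∈ Cs, ‖b n r s‖ * 1 :=
            Finset.sum_nonneg fun _ _ => Finset.sum_nonneg fun _ _ =>
              Finset.sum_nonneg fun _ _ => by positivity
          positivity) (by linarith)
    _ = _ := by rw [hL]; ring

end KloostermanQuintilinear

end Literature.NumberTheory.Sieve

end
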